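import Literature.Geometry.Lorentzian.Hintz2026.KerrTrappedSetDynamics

/-!
# Hintz 2026 [AF] §4.2.3 "Trapping I" and "Trapping III": the `(r, ξ)` PHASE PORTRAIT of the trapping leaf — (4.34)–(4.40),
# Def. 4.15, Def. 4.17 (4.47) and the DERIVATION of the expansion rate (4.48) ⇒ (4.49) via (4.51) — reproduced in the kernel
# for ALL `a² ≤ 𝔪²`, with the hyperbolic fixed point `(r', 0)` made explicit (exponents `±σν`, eigen-lines `T Γ^{u/s}`)

#harness_tags [topic Geometry/Lorentzian]

CITATION HEADER (lean-in-tree rule 2026-08-18).  P. Hintz, *(Non-)Linear waves on asymptotically flat spacetimes. II*,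
arXiv:2606.28008 **v1** (2026), bib key `Hintz2026WavesII` ("[AF]"; an UNREFEREED companion of the claim under adjudication
P. Hintz, *Nonlinear stability of subextremal Kerr black holes*, arXiv:2606.28253 **v2**, bib `Hintz2026`, "H"); "[AF] l.N" =
line N of its TeX source `nonstat2.tex` (md5 43f4362591de), numbers as in the `nonstat2.aux` shipped with H (= the public v1
PDF: (4.34) `EqTs3bOG0`, Lemma 4.11 `LemmaTs3bONonTrap`, Lemma 4.12 `LemmaTs3bOConv`, (4.37) `EqTs3bOPhiDouble`, (4.38)
`EqTs3bOPhiSign`, (4.39) `EqTs3bOGammapm0`, (4.40) `EqTs3bOGammapmFlow`, Def. 4.15 `DefTs3bOTrapus0`, Lemma 4.16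
`LemmaTs3bOTrapwtGamma`, Def. 4.17 / (4.47) `DefTs3bODefFn`/`EqTs3bODefFn`, (4.48) `EqTs3bOnu`, Lemma 4.18 `LemmaTs3bOnu`,
(4.49) `EqTs3bOnuExpr`, (4.51) `EqTs3bOnuSqrt`, Prop. 4.19 `PropTs3bONHyp`, (4.53) `EqTs3bONHypNorm`; printed pp.86–90 =
v1 PDF pp.122–126); "H l.N" = line N of `kerr-stab-r.tex` (md5 2c6513182847).  The REFEREED anchor is S. Dyatlov,
*Asymptotics of linear waves and resonances with applications to black holes*, Comm. Math. Phys. 335 (2015) 1445–1485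
(bib `Dyatlov2015`; held arXiv:1305.1723, whose §2.x / Prop. 2.x = journal §3.x / Prop. 3.x): [AF] l.4500 "The following
analysis of the dynamics in `r > r₊` closely follows Dyatlov"; Dyatlov's §3.2 prints the same objects (`Φ⁰`, "Case 2",
`Γ⁰_± = {ξ_r = ∓sgn(τ⁰)sgn(r − r')√(Φ⁰(r)/Δ_r(r))}`, `φ̃_± = ξ_r ∓ sgn(∂_τG)sgn(r − r')√(Φ/Δ_r)`, "Since `H_G` is tangent to
`Γ̃_±`, we have `H_Gφ̃_± = 0` on `Γ̃_±`", "By calculating `∂_{ξ_r}H_Gφ̃_±|_{K̃}`, we find … `ν̃ = √(−2Δ_r∂_r²G_r)/|∂_τG|`") with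
the opposite sign convention for `Φ⁰`.  Written by the audit cell `pub-kerr` (HINTZ-PLAN.md HP-43; GAPS.md C-A27; ADEP.md
§D.24), third of the trapping-leaf trilogy after module `KerrTrappedSet` ([AF] "Trapping II": `Γ₀`, HP-41) and module
`KerrTrappedSetDynamics` ("Trapping III–IV": the VALUE `ν²` of (4.49) and the algebra of Prop. 4.19(3), HP-42), which it
imports and whose scope notes "NOT formalised: … (un)stable manifolds `Γ₀^{u/s}`, Def. 4.15/4.17, …" it discharges in the
part that is one-variable calculus.  Nothing here is an estimate or a statement about perturbed metrics; no flow is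
constructed; every theorem is about the printed functions of `(r, ξ)` on a fixed fibre `(z, ζ)`.

## What is printed, and where it enters H

* H Prop. 8.3 `PropWETr` (H l.7395–7403) verifies [AF] Def. 5.8 (strong trapping admissibility at `Γ₀` with the constant
  `ν_min` of (4.50)) and then invokes [AF]'s semiclassical trapping theory, whose hypotheses at the trapped set are [AF] Thm 9.16
  `ThmSpHi` (Γ.2) "There exist smooth defining functions `φ^{u/s}` of `Γ^{u/s}` near `Γ` … such that `H_{G_1}φ^u = −ν^uφ^u`,
  `H_{G_1}φ^s = ν^sφ^s` … and `ν_min := min(inf_Γ ν^u, inf_Γ ν^s) > 0`" and (Γ.3) "`{φ^u, φ^s} > 0` and `dG_1 ≠ 0` on `Γ`"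
  ([AF] §9.3.4, l.8883–8894); for (asymptotically) Kerr these are supplied by [AF] Prop. 6.3 `PropDyTr` ("upon setting
  `φ^{u/s} := φ₀^{u/s} + φ̃^{u/s}`", l.5788–5799) and [AF] §9.1.2 l.7888–7896 ("restriction of the defining functions from
  Definition 4.17 yields defining functions `φ^{u/s}` … such that `H_{G_{+1}}φ^{u/s} = ∓ν^{u/s}φ^{u/s}`, `{φ^u, φ^s} ≠ 0`", l.7892–7896) —
  i.e. by exactly the objects of [AF] §4.2.3 "Trapping I/III" typed below, on exact Kerr.
* [AF] "Trapping I: dynamics in `(r, ξ)`" (l.4503–4603): Hamilton's equations "`ṙ = ∂_ξ𝒢`, `ξ̇ = −∂_r𝒢`, with `𝒢` being a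
  function of `(r, ξ)` only when `σ, η_ϕ` are fixed" (l.4511); **(4.34)** `𝒢⁰(r, ξ) := μ(r)ξ² + Φ⁰(r)`, `Φ⁰ := (V + 𝒞)|_{(z⁰,ζ⁰)}`;
  Lemma 4.11 (non-trapped fibres: "`d𝒢⁰ = (μ'ξ² + ∂_rΦ⁰)dr + 2μξ dξ` is nonzero …"); Lemma 4.12 (`Φ⁰ ≤ 0`, `∂_rΦ⁰ = 0` ⇒
  `∂_r²Φ⁰ < 0`; module 76); **(4.37)** the double zero `Φ⁰(r') = ∂_rΦ⁰(r') = 0` and **(4.38)** "`Φ⁰(r) < 0 ∀ r ∈ (r₊,∞), r ≠ r'`"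
  ("for if it failed, there would be a critical point of `Φ⁰` closest to `r'` which would need to be a negative local minimum
  or saddle point, contradicting Lemma 4.12", l.4566); **(4.39)** "`Σ_{(z⁰,ζ⁰)} = Γ^u ∪ Γ^s`,
  `Γ^{u/s} := {(r, ξ) : r > r₊, ξ = (+/−)sgn(r − r')√(−Φ⁰(r)/μ(r))}`, where we take the *positive* square root.  We have
  `Γ^u ∩ Γ^s = {(r', 0)}`" and "`H_{𝒢⁰}|_{(r',0)} = 0`, and hence … are *trapped*" (l.4579); **(4.40)** "On `Γ^u ∖ {(r',0)}`,
  we have `(r − r')H_{𝒢⁰}r = 2μξ(r − r') = 2μ|r − r'|√(−Φ⁰/μ) > 0`, with the sign reversed on `Γ^s`" (l.4580–4584).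
* [AF] "Trapping II/III": Def. 4.15 (the `𝔱`-invariant sets `Γ₀^{u/s}`, fibrewise the graphs of (4.39)); "Directly from the
  definitions, we have `Γ₀ = Γ₀^u ∩ Γ₀^s`.  Moreover, … the sets `Γ₀^{u/s}` are invariant under the `H_{G_3b}`-flow" (l.4662–4666);
  Def. 4.17 / **(4.47)** `φ₀^{u/s}(r, z; ξ, ζ) := ξ ∓ sgn(r − r'_{(z,ζ)})√(−Φ⁰_{(z,ζ)}(r)/μ(r))`; "we have `H_{G_3b}φ₀^{u/s} = 0` at
  `Γ₀^{u/s}`" (l.4698); **(4.48)** `(σ⁻¹H_{G_3b}φ₀^{u/s})|_Σ = ∓ν^{u/s}φ₀^{u/s}|_Σ`; **Lemma 4.18 / (4.49)**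
  `ν^{u/s}(r'_{(z,ζ)}, z; 0, ζ) = ν(z, ζ) := σ⁻¹√(−2μ(r'_{(z,ζ)})∂_r²Φ⁰_{(z,ζ)}(r'_{(z,ζ)}))` and "`{φ₀^u, φ₀^s}|_{Γ₀}` … is
  everywhere non-zero"; its proof (l.4719–4748): "it thus suffices to compute the limit of `(H_{G_3b}φ₀^{u/s})/(∓φ₀^{u/s})` at `Γ₀`
  *along `Γ₀^{s/u}`*.  But at `Γ₀^{s/u}`, we have `H_{G_3b}φ₀^{u/s} = H_{G_3b}(φ₀^{u/s} + φ₀^{s/u}) = H_{G_3b}(2ξ) = −2μ'ξ² + 2Ψ/μ²`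
  … `ξ²/(∓φ₀^{u/s}) → 0` … `∓φ₀^{u/s} = ∓2ξ = 2sgn(r − r')√(−Φ⁰/μ)` … **(4.51)** `√(−Φ⁰(r)/μ(r)) =
  √((−∂_r²Φ⁰/(2μ))|_{r'})(r − r')sgn(r − r') + 𝒪((r − r')²)` … `2Ψ/μ² = 2μ⁻²∂_rΨ(r')(r − r') + 𝒪((r − r')²)` … at `r = r'` we
  have `2μ⁻²∂_rΨ = 2∂_r(μ⁻²Ψ) = −2∂_r²V = −2∂_r²Φ⁰`, and the formula (4.49) follows.  For the final claim …
  `{φ₀^u, φ₀^s} = H_{φ₀^u}φ₀^s = H_{φ₀^u+φ₀^s}φ₀^s = 2H_ξφ₀^s = 2∂_rφ₀^s = 2√(−(∂_r²Φ⁰/2μ)|_{r'})`, which is indeed nonzero."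
* [AF] Prop. 4.19(2) / (4.53) (`|De^{s𝖧}(v)| ≤ Ce^{−μ|s|}|v|` on `N̄^{u/s}`) with its proof l.4852–4865 "`ν̃^{u/s} = (σ/(H_{G_3b}𝔱))ν^{s/u}
  > 0`" (l.4863): the exponential rates of the linearised flow transverse to the trapped set — modelled in §7 below by the 2×2
  Jacobian of the `(r, ξ)`-field at its fixed point.

## What the kernel certifies (real parameters `𝔪, a, σ, η_ϕ` and the Carter VALUE `C` of the fibre; `μ = r² − 2𝔪r + a²`)

§1 (4.34): `Phi0 = V + C` (module 76 `Vfn`), `sG0 = μξ² + Φ⁰` (`= 𝒢 + C`, `= G_3b` when `C = 𝒞(ζ)`: `sG0_eq_sG_add`, `sG0_eq_G3b`),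
the certified `∂_rΦ⁰ = −Ψ/μ²` (`hasDerivAt_Phi0`, from module 76 `hasDerivAt_V`), `∂_r²Φ⁰ =` module 78's `d2Phi`
(`hasDerivAt_dPhi0`), `∂_rΦ⁰ = 0 ⟺ Ψ = 0`, Hamilton's equations `∂_ξ𝒢⁰ = 2μξ = Hr`, `−∂_r𝒢⁰ = Hξ` against module 76's
`HGr`/`HGxi` (`hasDerivAt_sG0_xi/_r`), and Lemma 4.11's "`d𝒢⁰ ≠ 0`" (`dsG0_ne_zero`).
§2 **(4.37) ⇒ (4.38) for every `a² ≤ 𝔪²`** (`Phi0_neg_of_ne`): writing `a² = 𝔪² − s²`, `s ≥ 0` (so `r₊ = 𝔪 + s`, `μ > 0` beyond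
it: `mu_pos_of_gt`), on a fibre with `C > 0` (true on `Γ₀`: Lemma 4.14, module 76 `carterC_pos`) a double zero `Φ⁰(r') = Ψ(r') = 0`
at `r' > r₊` forces `Φ⁰(r) < 0` for all `r > r₊`, `r ≠ r'`.  The proof IS [AF]'s sentence, run as real analysis
(`neg_off_double_zero`: a point `x₁ ≠ r'` with `Φ⁰(x₁) ≥ 0` yields an interior minimum of `Φ⁰` on `[r', x₁]` with negative
value — a critical point in `{Φ⁰ ≤ 0}`, hence by Lemma 4.12 (module 76 `d2Phi_neg`, via `Afn_ne_zero_of_Phi0_nonpos`) a STRICT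
local maximum (`eventually_lt_of_deriv_zero_of_deriv2_neg`, mean value theorem) — absurd); hence the trapped radius of a fibre
is unique (`trapped_radius_unique`, [AF] l.4650 "which is then necessarily unique").
§3 **(4.39)–(4.40), Def. 4.15/4.17**: `u := −Φ⁰/μ` (`uFn`), the branch function `g := sgn(r − r')√u` (`brU`, `Real.sign`·`Real.sqrt`),
`φ₀^u := ξ − g`, `φ₀^s := ξ + g` (`phiU`, `phiS`, (4.47) verbatim); `φ₀^u + φ₀^s = 2ξ`; `g² = u` off `r'`; **`μ·φ₀^u·φ₀^s = 𝒢⁰`**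
(`mu_mul_phiU_mul_phiS`; so `{𝒢⁰ = 0} = {φ₀^u = 0} ∪ {φ₀^s = 0}`: `onSigma_iff` = (4.39)); **`φ₀^u = φ₀^s = 0 ⟺ (r, ξ) = (r', 0)`**
(`phiU_phiS_zero_iff` = "`Γ^u ∩ Γ^s = {(r',0)}`") and, against Def. 4.13's printed triple, **`⟺ ξ = 0 ∧ Ψ = 0 ∧ 𝒢⁰ = 0`**
(`gamma0_fibre` = "`Γ₀ = Γ₀^u ∩ Γ₀^s`"); **(4.40)** `(r − r')·Hr = 2μ|r − r'|√u > 0` on `Γ^u ∖ {(r',0)}`, `< 0` on `Γ^s ∖ {(r',0)}`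
(`escape_sign_unstable/_stable`).
§4 **invariance, computed**: the certified `r`-derivative `g' = sgn·u'/(2√u)` off `r'` (`hasDerivAt_brU_of_ne`, `dbrU`, `duFn`) and
**`H_{𝒢⁰}φ₀^s = (Hr)·g' + (Hξ)·1 = 0` on `Γ^s`**, **`H_{𝒢⁰}φ₀^u = 0` on `Γ^u`** (`HsG0_phiS_eq_zero`, `HsG0_phiU_eq_zero`; off
`(r',0)`, `Φ⁰ < 0 < μ`) — the infinitesimal content of "invariant under the `H_{G_3b}`-flow" / "`H_{G_3b}φ₀^{u/s} = 0` at `Γ₀^{u/s}`";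
and the printed step **`Hφ₀^u|_{Γ^s} = −2μ'ξ² + 2Ψ/μ²`** (`HsG0_phiU_on_GammaS`, with module 78 `HG_two_xi`), `−φ₀^u|_{Γ^s} = 2g`.
§5 **(4.51) as a derivative at `r'`**: `Φ⁰(r)/(r − r')² → ½∂_r²Φ⁰(r')` (`tendsto_Phi0_div_sq`, l'Hôpital on the certified
derivatives), `u/(r − r')² → c² := −∂_r²Φ⁰(r')/(2μ(r'))` (`tendsto_uFn_div_sq`), `g = (r − r')√(u/(r − r')²)` off `r'`, hence
**`HasDerivAt g c r'`** with **`c = slopeC := √(−∂_r²Φ⁰(r')/(2μ(r')))`** (`hasDerivAt_brU_rprime`; only `μ(r') ≠ 0`,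
`Φ⁰(r') = Ψ(r') = 0` needed); `c > 0` at every trapped radius for `a² ≤ 𝔪²` (`slopeC_pos`, Lemma 4.12) — the transversality
`Γ^u ⋔ Γ^s` of Lemma 4.16(2) at the level of tangent slopes `±c`; and **`2μ(r')c = σ√(ν²)`** with module 78's `nuSq` (`two_mu_mul_slopeC`).
§6 **LEMMA 4.18, THE DERIVATION (4.48) ⇒ (4.49)**: [AF]'s quotient `Q(r) := σ⁻¹(Hφ₀^u)/(−φ₀^u)` at `(r, −g(r)) ∈ Γ^s` (`afQuot`,
with the printed values of §4) satisfies **`Q(r) → √(ν²(r'))` as `r → r'`, `r ≠ r'`** (`tendsto_afQuot`; hypotheses: `a² = 𝔪² − s²`,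
`s ≥ 0`, `C > 0`, `r' > 𝔪 + s`, `Φ⁰(r') = Ψ(r') = 0`, `σ > 0` = the future half) — the number defined dynamically by (4.48) IS (4.49),
whose square module 78 evaluates in closed form; the two printed ingredients appear as `−μ'(r − r')·G → 0` and
`(Ψ/(r − r'))/(μ²G) → ∂_rΨ(r')/(μ(r')²c)` with `G := √(u/(r−r')²) → c`; **Lemma 4.18's final claim** `{φ₀^u, φ₀^s}|_{r'} =
1·c − (−c)·1 = 2c > 0` with both partials certified (`poisson_phiU_phiS_rprime`); and **Dyatlov's route**
`−σ⁻¹∂_ξ(Hφ₀^u)|_{(r',0)} = 2μ(r')c/σ = √(ν²)` (`dyatlov_rate`).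
§7 THE HYPERBOLIC FIXED POINT (computed here from (4.32)/(4.34)): the field `(Hr, Hξ) = (2μξ, −(μ'ξ² + ∂_rΦ⁰))` vanishes at `(r', 0)`
iff `Ψ(r') = 0` (`field_zero_iff`, l.4579); its four partials (`hasDerivAt_HGr_r/_xi`, `hasDerivAt_HGxi_r/_xi`) give the Jacobian
**`J = [[0, 2μ(r')], [−∂_r²Φ⁰(r'), 0]]`** (`linJac`, `linJac_entries`), `tr J = 0`, `det J = 2μ∂_r²Φ⁰ < 0` — a SADDLE
(`linJac_trace_det`, `linJac_det_neg`), **`J² = σ²ν²·1`** (`linJac_sq`: eigenvalues `±σν`), and **`J(1, ±c) = ±2μc·(1, ±c) =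
±σν·(1, ±c)`** (`linJac_eigen`): the tangent lines of `Γ^u` / `Γ^s` at `(r', 0)` (slopes `±c`, §5) are the expanding / contracting
directions, with rate `σν` per unit of `σ⁻¹H_{G_3b}`-time, i.e. `ν̃ = σν/(H_{G_3b}𝔱)` in `𝔱`-time (`rate_in_t_time` = module 78 `nuNormSq`,
[AF] l.4863).
§8 ON `Γ₀`: every point of module 76's `OnGamma0` (BL chart, `0 < sin²θ ≤ 1`) and of module 78's `OnGamma0Pol` (polar chart, poles
included) is such a fibre (`trapped_fibre_of_onGamma0(_Pol)`), and on `Γ₀ ∖ o ∩ Σ⁺` for `a² = 𝔪² − s² ≤ 𝔪²`, `r' > 𝔪 + s`: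
(4.38), `Q → √ν²`, `ν² = 16r'((r'−𝔪)³ + 𝔪(𝔪²−a²))/(r'−𝔪)² > 0` (`expansion_rate_on_Gamma0`, `expansion_rate_on_Gamma0_pol`; inputs
`𝒞 > 0`, `σ > 0`, `A ≠ 0` from modules 76/78).
§9 TWO WORKED FIBRES in closed form (v2; computed here): SCHWARZSCHILD `a = 0` — `Ψ = 2r⁴σ²(r − 3𝔪)` (so `r' = 3𝔪`), with
`C = 27𝔪²σ²`: **`Φ⁰(r) = −σ²(r − 3𝔪)²(r + 6𝔪)/(r − 2𝔪)`** (`Phi0_schwarzschild`; (4.37)–(4.38) read off: `Phi0_schwarzschild_neg`),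
`c = √3σ/𝔪`, `√ν² = 6√3𝔪 = 2μ(3𝔪)c/σ` (`slopeC_schwarzschild`, `rate_schwarzschild`; Dyatlov Prop. 3.8 at `Λ = 0`: `ν̃ = 1/(3√3M)`
with module 78's `H_G𝔱 = 54𝔪²σ`); and an EXTREMAL fibre `a = 𝔪`, `η_ϕ = 𝔪σ`, `C = 16𝔪²σ²`: **`Φ⁰(r) = −σ²(r − 2𝔪)²(r² + 4𝔪r −
4𝔪²)/(r − 𝔪)²`** (`Phi0_extremal_fibre`), trapped at `r' = 2𝔪` with `Φ⁰ < 0` elsewhere on `r > 𝔪 = r₊` and `ν² = 32𝔪²`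
(`extremal_fibre_trapped`) — the fibrewise portrait is non-degenerate at extremality.

Deviations from print (said once): [AF] derives `A ≠ 0` inside Lemma 4.12 from `B² ≤ 𝒞 ≤ μ⁻¹A²` and the zero section; the
kernel feeds Lemma 4.12 with `C > 0` (Lemma 4.14's `𝒞 > 0` on `Γ₀`, module 76) which gives `A ≠ 0` wherever `Φ⁰ ≤ 0` in one
line.  [AF] normalises `σ = 1`; the kernel keeps `σ > 0`.  (4.51) is certified as differentiability with the printed slope
(`o(r − r')`), not with the printed `𝒪((r − r')²)` remainder.  The invariance (§4) is proved by differentiating the printed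
functions, not deduced from the flow.  NOT formalised: flows / integral curves and "escape to `r₊` or `∞`" (Lemma 4.11's and
(4.40)'s dynamical conclusions), Lemma 4.16 (manifold / smoothness / homogeneity statements, `Γ̃₀`), Def. 4.17's extensions
off `Γ̃₀ × T*(r₊,∞)`, (4.48) as a DEFINITION of functions `ν^{u/s}` on a neighbourhood (the kernel certifies the limit that
[AF]'s proof computes and Dyatlov's `∂_ξ`-characterisation), the infimum in (4.50) (module 78 gives a uniform explicit lower
bound instead), Prop. 4.19 as dynamics (Hirsch–Pugh–Shub), anything of H §6/§8 or of perturbed metrics ([AF] Prop. 6.3).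
|a|-census (ADEP.md §D.24): NOTHING in this file uses smallness or even strict subextremality — §§1, 3, 4, 5, 7 hold for
every real `a` given `μ > 0` at the radii concerned; §2, §6, §8 are stated for `a² = 𝔪² − s²` with `s ≥ 0`, i.e. `a² ≤ 𝔪²`
INCLUDING the extremal case (on `r > r₊ = 𝔪 + s` one has `μ = (r−𝔪)² − s² > 0` and Lemma 4.12 needs only `a² ≤ 𝔪²`); what
degenerates as `|a| → 𝔪` is not the phase portrait of a trapped fibre but the location of the fibres (the shell `[r_ph⁺, r_ph⁻]`
reaches `r₊`, module 76) and the infimum `ν_min` (module 78).  Engines (cell `pub-kerr`, `code/adep1-g25/`): A = sympy 1.14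
symbolic (42 checks: the derivatives, `μφ₀^uφ₀^s = 𝒢⁰`, `Hφ₀^{s/u} = 0` on `Γ^{s/u}` for both signs, the printed step l.4730, the
limits (4.51) and (4.48)⇒(4.49) on a generic second-order radicand profile, Dyatlov's `∂_ξ` route, `2μc = σν`, the Jacobian,
`J²`, the eigenvectors, the Poisson bracket, and (v2) the two closed-form fibres of §9 — PASS), B = standard library only (exact rationals: every identity at random points
with `√u` rational by construction; 296 exact trapped fibres of subextremal and 8 of extremal Kerr built from Pythagorean
`(𝔪, s, a)` and the trapped relation (4.35), on which (4.38) is checked on a radial grid, `ν²` against the closed form, the saddle,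
and in 60-digit decimals the limits `g/(r − r') → c`, `Q → √ν²` with errors `∝ |r − r'|` down to `10⁻⁸`; 14736 checks, 0 fails).
[cite: Hintz2026WavesII, §4.2.3 'Trapping I' TeX l.4503-4603: l.4511 (Hamilton's equations), (4.34) `EqTs3bOG0` l.4520-4524, Lemma 4.11 l.4531-4537, (4.37)-(4.38) l.4561-4570, (4.39)-(4.40) l.4571-4584 incl. 'Γ^u ∩ Γ^s = {(r′,0)}' and 'H_{𝒢⁰}|_{(r′,0)} = 0' l.4579; 'Trapping II/III' Def. 4.13 l.4607-4615, l.4650 ('necessarily unique'), Def. 4.15 `DefTs3bOTrapus0` l.4652-4660, l.4662-4666 ('Γ₀ = Γ₀^u ∩ Γ₀^s', invariance), Lemma 4.16(2) l.4673/4681, Def. 4.17/(4.47) `DefTs3bODefFn` l.4688-4696, l.4698, (4.48) `EqTs3bOnu` l.4699-4702, Lemma 4.18 `LemmaTs3bOnu` l.4705-4718 with (4.49) `EqTs3bOnuExpr` l.4708-4711, its proof l.4719-4748 with l.4728-4732, (4.51) `EqTs3bOnuSqrt` l.4733-4737, l.4738-4741, l.4743-4747 (v1 PDF pp.122-126, printed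 pp.86-90; claims of an unrefereed preprint, reproduced here); Hintz2026WavesII, Prop. 4.19(2) eq. (4.53) l.4775-4779 and proof l.4852-4865 ('ν̃^{u/s} = (σ/(H_{G_3b}𝔱))ν^{s/u}', l.4863), l.4752-4758 ('𝖧 := H_{G_3b}/(H_{G_3b}𝔱)'); Hintz2026WavesII, Prop. 6.3 `PropDyTr` l.5788-5799, §9.1.2 l.7888-7896, §9.3.4 (Γ.1)-(Γ.3) l.8883-8894 = the trapping hypotheses of Thm 9.16 `ThmSpHi` (where φ₀^{u/s}, ν^{u/s}, {φ^u,φ^s} > 0 are consumed); Hintz2026, Prop. 8.3 `PropWETr` TeX l.7395-7403 (the import site); Dyatlov2015, §3.2 'Structure of the trapped set' (held arXiv text §2.2 pp.15-18: Prop. 2.4 (e:Phi-helper-1), 'Case 2' with Γ⁰_±, Prop. 2.5 (tails Γ̃_±, 'r′ is the only solution', 'intersecting transversely', 'their intersection is equal to K̃'), φ̃_±, 'H_G φ̃_± = 0 on Γ̃_±', (e:reno), 'By calculating ∂_{ξ_r}H_G φ̃_±|_{K̃}' and (e:tilde-nu) = journal Prop. 3.4-3.5 and the display before Prop. 3.7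)]
-/

open Matrix Filter Topology

noncomputable section

namespace Literature.Geometry.Lorentzian.Hintz2026.KerrTrappingPhasePortrait

open Literature.Geometry.Lorentzian.Hintz2026.KerrDualMetricForm
open Literature.Geometry.Lorentzian.Hintz2026.CarterTetradFrame
open Literature.Geometry.Lorentzian.Hintz2026.KerrTrappedSet
open Literature.Geometry.Lorentzian.Hintz2026.KerrTrappedSetDynamics

/-! ## 0. Two one-line facts about `Real.sign` used throughout (`sgn(r − r')` in (4.39), (4.47)); the third one needed,
`sgn(x)·x = |x|`, is already in the tree (`Literature.Analysis.FunctionSpaces.BMOInv.real_sign_mul_self_eq_abs`) and is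
re-derived inline where (4.40) uses it rather than importing that unrelated module -/

/-- `sgn(x)² = 1` for `x ≠ 0` — so `(sgn(r − r')√u)² = u` off `r'` in (4.39)/(4.47).
[cite: Hintz2026WavesII, eq. (4.39) `EqTs3bOGammapm0` TeX l.4576 (elementary fact about sgn used there; proved here)] -/
theorem sign_sq_eq_one {x : ℝ} (hx : x ≠ 0) : Real.sign x ^ 2 = 1 := by
  rcases Real.sign_apply_eq_of_ne_zero x hx with h | h <;> rw [h] <;> norm_num

/-- `x/|x| = sgn(x)` for `x ≠ 0` — so `sgn(r − r')√u = (r − r')√(u/(r − r')²)` in (4.51).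
[cite: Hintz2026WavesII, eq. (4.51) `EqTs3bOnuSqrt` TeX l.4735 ('(r − r′)sgn(r − r′)'; elementary fact, proved here)] -/
theorem self_div_abs_eq_sign {x : ℝ} (hx : x ≠ 0) : x / |x| = Real.sign x := by
  rcases lt_or_gt_of_ne hx with h | h
  · rw [abs_of_neg h, Real.sign_of_neg h, div_neg, div_self hx]
  · rw [abs_of_pos h, Real.sign_of_pos h, div_self hx]

/-! ## 1. [AF] (4.34) `EqTs3bOG0`: the potential `Φ⁰(r) := (V + 𝒞)|_{(z,ζ)}` and `𝒢⁰(r, ξ) := μ(r)ξ² + Φ⁰(r)` -/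

section Potential

variable (m a σ ηφ C ρ ξ : ℝ)

/-- **(4.34), the "potential function"** `Φ⁰_{(z⁰,ζ⁰)}(r) := (V + 𝒞)|_{(z,ζ)=(z⁰,ζ⁰)}` as a function of `r` alone: `V = −A²/μ`
depends on `(r; σ, η_ϕ)` (module 76 `Vfn`) and the Carter function `𝒞` — "which only depends on `(z⁰, ζ⁰)`" and is conserved —
enters as the real PARAMETER `C` (its value `carterC a sin²θ σ η_θ η_ϕ` on the fibre).
[cite: Hintz2026WavesII, eq. (4.34) `EqTs3bOG0` TeX l.4520-4524 (transcription)] -/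
def Phi0 (m a σ ηφ C ρ : ℝ) : ℝ := Vfn m a ρ σ ηφ + C

/-- **(4.34)** `𝒢⁰_{(z⁰,ζ⁰)}(r, ξ) := μ(r)ξ² + Φ⁰_{(z⁰,ζ⁰)}(r)` — "`𝒢` … a function of `r, ξ` only, with parametric dependence on
`(z⁰, ζ⁰)`". [cite: Hintz2026WavesII, eq. (4.34) `EqTs3bOG0` TeX l.4520-4524 (transcription)] -/
def sG0 (m a σ ηφ C ρ ξ : ℝ) : ℝ := mu m a ρ * ξ ^ 2 + Phi0 m a σ ηφ C ρ

/-- `∂_rΦ⁰ = ∂_rV = −Ψ/μ²` (only `V` depends on `r`; (4.31) `Ψ := −μ²∂_rV`), the certified value of module 76 `hasDerivAt_V`.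
[cite: Hintz2026WavesII, eq. (4.31) `EqTs3bOPsi` TeX l.4471 and proof of Lemma 4.12 l.4544 ('∂_rΦ⁰ = ∂_rV = −μ⁻²Ψ'; transcription)] -/
def dPhi0 (m a σ ηφ ρ : ℝ) : ℝ := -Psi m a ρ σ ηφ / mu m a ρ ^ 2

/-- `𝒢⁰ = 𝒢 + C` (module 76 `sG = μξ² + V`). [cite: Hintz2026WavesII, eq. (4.34) with (4.32) TeX l.4477 (reproduced)] -/
theorem sG0_eq_sG_add : sG0 m a σ ηφ C ρ ξ = sG m a ρ σ ξ ηφ + C := by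
  simp only [sG0, Phi0, sG]; ring

/-- On the fibre `C = 𝒞(ζ⁰)`: `𝒢⁰ = G_3b = 𝒢 + 𝒞` ((4.32)). [cite: Hintz2026WavesII, eq. (4.32)/(4.34) TeX l.4477, l.4521 (reproduced)] -/
theorem sG0_eq_G3b (s2 ηθ : ℝ) : sG0 m a σ ηφ (carterC a s2 σ ηθ ηφ) ρ ξ = G3b m a ρ s2 σ ξ ηθ ηφ := by
  simp only [sG0, Phi0, G3b, sG]; ring

/-- `Φ⁰` is differentiable in `r` off `{μ = 0}` with `∂_rΦ⁰ = −Ψ/μ²`. [cite: Hintz2026WavesII, proof of Lemma 4.12 TeX l.4544 (reproduced)] -/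
theorem hasDerivAt_Phi0 (hμ : mu m a ρ ≠ 0) :
    HasDerivAt (fun x => Phi0 m a σ ηφ C x) (dPhi0 m a σ ηφ ρ) ρ := by
  unfold Phi0 dPhi0
  exact ((hasDerivAt_V m a ρ σ ηφ hμ).add_const C)

/-- `∂_r(∂_rΦ⁰) = ∂_r²Φ⁰` is module 78's `d2Phi` (module 76 `hasDerivAt_dPhi`). [cite: Hintz2026WavesII, proof of Lemma 4.12 TeX l.4544-4549 and proof of Lemma 4.18 l.4746 (reproduced)] -/
theorem hasDerivAt_dPhi0 (hμ : mu m a ρ ≠ 0) :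
    HasDerivAt (fun x => dPhi0 m a σ ηφ x) (d2Phi m a ρ σ ηφ) ρ := by
  unfold dPhi0
  exact hasDerivAt_dPhi_eq m a ρ σ ηφ hμ

/-- `∂_rΦ⁰ = 0 ⟺ Ψ = 0` (`μ ≠ 0`): the critical points of the potential are the zeros of `Ψ`.
[cite: Hintz2026WavesII, proof of Lemma 4.12 TeX l.4544 ('∂_rΦ⁰ = ∂_rV = −μ⁻²Ψ = 0'; reproduced)] -/
theorem dPhi0_eq_zero_iff (hμ : mu m a ρ ≠ 0) : dPhi0 m a σ ηφ ρ = 0 ↔ Psi m a ρ σ ηφ = 0 := by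
  unfold dPhi0
  rw [div_eq_zero_iff, neg_eq_zero]
  exact ⟨fun h => h.resolve_right (pow_ne_zero 2 hμ), fun h => Or.inl h⟩

/-- Hamilton's equations in `(r, ξ)`: "`ṙ = ∂_ξ𝒢`" — `∂_ξ𝒢⁰ = 2μξ = H_{G_3b}r` (module 76 `HGr`).
[cite: Hintz2026WavesII, TeX l.4511 ('Hamilton's equations for r, ξ thus read ṙ = ∂_ξ𝒢, ξ̇ = −∂_r𝒢') with (4.32) l.4479 (reproduced)] -/
theorem hasDerivAt_sG0_xi : HasDerivAt (fun x => sG0 m a σ ηφ C ρ x) (HGr m a ρ ξ) ξ := by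
  unfold sG0 HGr
  exact (((hasDerivAt_const ξ (mu m a ρ)).mul ((hasDerivAt_id' (x := ξ)).pow 2)).add_const
    (Phi0 m a σ ηφ C ρ)).congr_deriv (by simp; ring)

/-- "`ξ̇ = −∂_r𝒢`" — `∂_r𝒢⁰ = μ'ξ² + ∂_rΦ⁰ = μ'ξ² − Ψ/μ²`, so `−∂_r𝒢⁰ = H_{G_3b}ξ` (module 76 `HGxi`; `μ ≠ 0`).
[cite: Hintz2026WavesII, TeX l.4511 with (4.32) l.4479 (reproduced)] -/
theorem hasDerivAt_sG0_r (hμ : mu m a ρ ≠ 0) :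
    HasDerivAt (fun x => sG0 m a σ ηφ C x ξ) (-HGxi m a ρ σ ξ ηφ) ρ := by
  unfold sG0 HGxi
  exact (((hasDerivAt_mu m a ρ).mul_const (ξ ^ 2)).add (hasDerivAt_Phi0 m a σ ηφ C ρ hμ)).congr_deriv
    (by unfold dPhi0; ring)

/-- The printed differential of Lemma 4.11's proof: `d𝒢⁰ = (μ'ξ² + ∂_rΦ⁰)dr + 2μξ dξ` "is nonzero when `ξ ≠ 0`.  When `ξ = 0` and
`𝒢⁰ = 0`, then also `Φ⁰ = 0`, and therefore `∂_rΦ⁰ ≠ 0`" under the lemma's hypothesis "`Φ⁰ = 0` implies `∂_rΦ⁰ ≠ 0`" — so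
`d𝒢⁰ ≠ 0` on the zero set (`μ ≠ 0`). [cite: Hintz2026WavesII, Lemma 4.11 `LemmaTs3bONonTrap` and its proof TeX l.4531-4537 (reproduced: the non-vanishing of the differential; the escape statement is dynamics and is not formalised)] -/
theorem dsG0_ne_zero (hμ : mu m a ρ ≠ 0) (hyp : Phi0 m a σ ηφ C ρ = 0 → dPhi0 m a σ ηφ ρ ≠ 0)
    (hG : sG0 m a σ ηφ C ρ ξ = 0) : ¬(-HGxi m a ρ σ ξ ηφ = 0 ∧ HGr m a ρ ξ = 0) := by
  rintro ⟨hr, hx⟩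
  have hξ : ξ = 0 := (HGr_eq_zero_iff m a ρ ξ hμ).mp hx
  subst hξ
  have hΦ : Phi0 m a σ ηφ C ρ = 0 := by simpa [sG0] using hG
  apply hyp hΦ
  rw [(HG2r_at_xi_zero m a ρ σ ηφ hμ).1, neg_eq_zero] at hr
  rw [dPhi0, neg_div, hr, neg_zero]

end Potential

/-! ## 2. [AF] (4.37) ⇒ (4.38) `EqTs3bOPhiSign`: a double zero `r'` of `Φ⁰` forces `Φ⁰ < 0` everywhere else on `(r₊, ∞)` —
the one-dimensional analysis, run on module 76's Lemma 4.12 (`d2Phi_neg`) -/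

section GlobalSign

/-- Strictness behind "non-degenerate maximum": if `f` has derivative `f'` near `c`, `f' c = 0` and `f'` has a NEGATIVE
derivative `d` at `c`, then `f x < f c` for all `x ≠ c` near `c` (mean value theorem on the sign of `f'`).
[cite: Hintz2026WavesII, TeX l.4566 ('we have ∂_r²Φ⁰ < 0, and therefore (r − r′)∂_rΦ⁰(r) < 0 for all r … that are close to r′') and l.4579 ('Φ⁰ has a non-degenerate maximum at r = r′'); the calculus fact used, proved here] -/
theorem eventually_lt_of_deriv_zero_of_deriv2_neg {f f' : ℝ → ℝ} {c d : ℝ}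
    (hf : ∀ᶠ x in 𝓝 c, HasDerivAt f (f' x) x) (hc : f' c = 0) (hf' : HasDerivAt f' d c) (hd : d < 0) :
    ∀ᶠ x in 𝓝[≠] c, f x < f c := by
  -- the sign of `f'` near `c`: `f' x / (x - c) → d < 0`
  have hslope : Tendsto (fun x => (f' x - f' c) / (x - c)) (𝓝[≠] c) (𝓝 d) := by
    have h := hf'.tendsto_slope
    rwa [slope_fun_def_field] at h
  have hsgn : ∀ᶠ x in 𝓝[≠] c, f' x / (x - c) < 0 := by
    have h := hslope.eventually (gt_mem_nhds hd)
    simpa [hc] using h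
  -- a ball on which `f` is differentiable with derivative `f'` and the sign condition holds
  obtain ⟨ε, hε, hball⟩ := Metric.eventually_nhds_iff.mp hf
  obtain ⟨δ, hδ, hball'⟩ := Metric.eventually_nhds_iff.mp (eventually_nhdsWithin_iff.mp hsgn)
  rw [eventually_nhdsWithin_iff, Metric.eventually_nhds_iff]
  refine ⟨min ε δ, lt_min hε hδ, fun x hx hxc => ?_⟩
  have hxε : dist x c < ε := lt_of_lt_of_le hx (min_le_left _ _)
  have hxδ : dist x c < δ := lt_of_lt_of_le hx (min_le_right _ _)
  -- every point between `x` and `c` is in both balls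
  have hseg : ∀ y, y ∈ Set.uIcc x c → dist y c < ε ∧ dist y c < δ := by
    intro y hy
    have : dist y c ≤ dist x c := by
      rw [Set.mem_uIcc] at hy
      rw [Real.dist_eq, Real.dist_eq]
      rcases hy with ⟨h1, h2⟩ | ⟨h1, h2⟩
      · rw [abs_of_nonpos (by linarith), abs_of_nonpos (by linarith)]; linarith
      · rw [abs_of_nonneg (by linarith), abs_of_nonneg (by linarith)]; linarith
    exact ⟨lt_of_le_of_lt this hxε, lt_of_le_of_lt this hxδ⟩
  have hderiv : ∀ y ∈ Set.uIcc x c, HasDerivAt f (f' y) y := fun y hy => hball (hseg y hy).1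
  have hcont : ContinuousOn f (Set.uIcc x c) := fun y hy => (hderiv y hy).continuousAt.continuousWithinAt
  rcases lt_or_gt_of_ne hxc with hlt | hgt
  · -- `x < c`: `f c - f x = f' y (c - x)` with `f' y > 0`
    have huI : Set.uIcc x c = Set.Icc x c := Set.uIcc_of_le hlt.le
    obtain ⟨y, hy, hyslope⟩ := exists_hasDerivAt_eq_slope f f' hlt (by rw [← huI]; exact hcont)
      (fun y hy => hderiv y (by rw [huI]; exact Set.Ioo_subset_Icc_self hy))
    have hyc : y ≠ c := ne_of_lt hy.2
    have hsign : f' y / (y - c) < 0 := hball' (hseg y (by rw [huI]; exact Set.Ioo_subset_Icc_self hy)).2 hyc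
    have hneg : y - c < 0 := by linarith [hy.2]
    have hpos : 0 < f' y := by
      rcases le_or_gt (f' y) 0 with h | h
      · exact absurd hsign (not_lt.mpr (div_nonneg_of_nonpos h hneg.le))
      · exact h
    have hcx : 0 < c - x := by linarith
    have key : f c - f x = f' y * (c - x) := by rw [hyslope, div_mul_cancel₀ _ hcx.ne']
    nlinarith
  · -- `c < x`: `f x - f c = f' y (x - c)` with `f' y < 0`
    have huI : Set.uIcc x c = Set.Icc c x := Set.uIcc_of_ge hgt.le
    obtain ⟨y, hy, hyslope⟩ := exists_hasDerivAt_eq_slope f f' hgt (by rw [← huI]; exact hcont)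
      (fun y hy => hderiv y (by rw [huI]; exact Set.Ioo_subset_Icc_self hy))
    have hyc : y ≠ c := ne_of_gt hy.1
    have hsign : f' y / (y - c) < 0 := hball' (hseg y (by rw [huI]; exact Set.Ioo_subset_Icc_self hy)).2 hyc
    have hposy : 0 < y - c := by linarith [hy.1]
    have hneg : f' y < 0 := by
      rcases le_or_gt 0 (f' y) with h | h
      · exact absurd hsign (not_lt.mpr (div_nonneg h hposy.le))
      · exact h
    have hcx : 0 < x - c := by linarith
    have key : f x - f c = f' y * (x - c) := by rw [hyslope, div_mul_cancel₀ _ hcx.ne']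
    nlinarith

/-- The one-dimensional argument of [AF] l.4566–4570 in abstract form: on an open half-line `(b, ∞)` let `f` be differentiable
with derivative `f'`, itself differentiable with derivative `f''`, and suppose the CONVEXITY RESULT of Lemma 4.12 holds:
"`f ≤ 0` and `f' = 0` imply `f'' < 0`".  If `f(r') = f'(r') = 0` at some `r' > b` (a double zero, (4.37)), then `f < 0` on
`(b, ∞) ∖ {r'}` ((4.38)).  ([AF]: "for if it failed, there would be a critical point of `Φ⁰` … which would need to be a negative
local minimum or saddle point, contradicting Lemma 4.12"; here: a point `x₁ ≠ r'` with `f(x₁) ≥ 0` gives an interior minimum of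
`f` on `[r', x₁]` with negative value, a critical point with `f ≤ 0`, hence a strict local maximum — absurd.)
[cite: Hintz2026WavesII, (4.37)-(4.38) `EqTs3bOPhiDouble`/`EqTs3bOPhiSign` and the sentence between them, TeX l.4561-4570 (reproduced); Dyatlov2015, §3.2 Case 2 after Prop. 3.4 (held arXiv text p.17: '(r − r′)∂_rΦ⁰(r) > 0 for r ≠ r′', with the opposite sign convention for Φ⁰)] -/
theorem neg_off_double_zero {f f' f'' : ℝ → ℝ} {b r' : ℝ}
    (hf : ∀ x, b < x → HasDerivAt f (f' x) x) (hf' : ∀ x, b < x → HasDerivAt f' (f'' x) x)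
    (convex : ∀ x, b < x → f x ≤ 0 → f' x = 0 → f'' x < 0)
    (hr' : b < r') (h0 : f r' = 0) (h1 : f' r' = 0) :
    ∀ x, b < x → x ≠ r' → f x < 0 := by
  -- strict local max at every critical point of `{f ≤ 0}`
  have strict : ∀ c, b < c → f c ≤ 0 → f' c = 0 → ∀ᶠ x in 𝓝[≠] c, f x < f c := by
    intro c hc hfc hf'c
    have hnhds : ∀ᶠ x in 𝓝 c, HasDerivAt f (f' x) x := by
      filter_upwards [Ioi_mem_nhds hc] with x hx using hf x hx
    exact eventually_lt_of_deriv_zero_of_deriv2_neg hnhds hf'c (hf' c hc) (convex c hc hfc hf'c)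
  intro x₁ hx₁ hne
  by_contra hge
  rw [not_lt] at hge
  -- the segment between r' and x₁
  set p := min r' x₁ with hp
  set q := max r' x₁ with hq
  have hpq : p < q := by
    rcases lt_or_gt_of_ne hne with h | h
    · rw [hp, hq, min_eq_right h.le, max_eq_left h.le]; exact h
    · rw [hp, hq, min_eq_left h.le, max_eq_right h.le]; exact h
  have hbp : b < p := lt_min hr' hx₁
  have hIcc : ∀ y ∈ Set.Icc p q, b < y := fun y hy => lt_of_lt_of_le hbp hy.1
  have hcont : ContinuousOn f (Set.Icc p q) := fun y hy => (hf y (hIcc y hy)).continuousAt.continuousWithinAt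
  -- a point of the open segment near r' where f < 0
  have hex : ∃ y ∈ Set.Ioo p q, f y < 0 := by
    have hev := strict r' hr' (le_of_eq h0) h1
    rw [h0] at hev
    obtain ⟨ε, hε, hball⟩ := Metric.eventually_nhds_iff.mp (eventually_nhdsWithin_iff.mp hev)
    rcases lt_or_gt_of_ne hne with h | h
    · -- x₁ < r' : take y = r' - t
      have hp' : p = x₁ := by rw [hp, min_eq_right h.le]
      have hq' : q = r' := by rw [hq, max_eq_left h.le]
      set t := min (ε / 2) ((r' - x₁) / 2) with ht
      have htpos : 0 < t := lt_min (by linarith) (by linarith)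
      have htε : t < ε := lt_of_le_of_lt (min_le_left _ _) (by linarith)
      have htx : x₁ < r' - t := by
        have : t ≤ (r' - x₁) / 2 := min_le_right _ _
        linarith
      refine ⟨r' - t, ⟨by rw [hp']; exact htx, by rw [hq']; linarith⟩, ?_⟩
      refine hball ?_ (by simp; linarith)
      rw [Real.dist_eq, show r' - t - r' = -t by ring, abs_neg, abs_of_pos htpos]
      exact htε
    · -- r' < x₁ : take y = r' + t
      have hp' : p = r' := by rw [hp, min_eq_left h.le]
      have hq' : q = x₁ := by rw [hq, max_eq_right h.le]
      set t := min (ε / 2) ((x₁ - r') / 2) with ht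
      have htpos : 0 < t := lt_min (by linarith) (by linarith)
      have htε : t < ε := lt_of_le_of_lt (min_le_left _ _) (by linarith)
      have htx : r' + t < x₁ := by
        have : t ≤ (x₁ - r') / 2 := min_le_right _ _
        linarith
      refine ⟨r' + t, ⟨by rw [hp']; linarith, by rw [hq']; exact htx⟩, ?_⟩
      refine hball ?_ (by simp; linarith)
      rw [Real.dist_eq, show r' + t - r' = t by ring, abs_of_pos htpos]
      exact htε
  obtain ⟨y, hy, hfy⟩ := hex
  -- the minimum of f on [p, q]
  obtain ⟨c, hc, hmin⟩ := (isCompact_Icc (a := p) (b := q)).exists_isMinOn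
    (Set.nonempty_Icc.mpr hpq.le) hcont
  have hfc : f c < 0 := lt_of_le_of_lt (hmin (Set.Ioo_subset_Icc_self hy)) hfy
  -- c is not an endpoint: the endpoints are {r', x₁} where f ≥ 0
  have hfpq : 0 ≤ f p ∧ 0 ≤ f q := by
    rcases le_total r' x₁ with h | h
    · rw [hp, hq, min_eq_left h, max_eq_right h]; exact ⟨h0.symm.le, hge⟩
    · rw [hp, hq, min_eq_right h, max_eq_left h]; exact ⟨hge, h0.symm.le⟩
  have hcp : c ≠ p := fun h => by rw [h] at hfc; linarith [hfpq.1]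
  have hcq : c ≠ q := fun h => by rw [h] at hfc; linarith [hfpq.2]
  have hcI : c ∈ Set.Ioo p q := ⟨lt_of_le_of_ne hc.1 (Ne.symm hcp), lt_of_le_of_ne hc.2 hcq⟩
  have hbc : b < c := hIcc c hc
  -- local min ⇒ critical point ⇒ (Lemma 4.12) strict local max: contradiction
  have hloc : IsLocalMin f c := hmin.isLocalMin (Icc_mem_nhds hcI.1 hcI.2)
  have hcrit : f' c = 0 := hloc.hasDerivAt_eq_zero (hf c hbc)
  have hstrict := strict c hbc hfc.le hcrit
  have hboth : ∀ᶠ x in 𝓝[≠] c, f x < f c ∧ f c ≤ f x :=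
    hstrict.and (nhdsWithin_le_nhds hloc)
  obtain ⟨x, hx1, hx2⟩ := hboth.exists
  exact absurd hx1 (not_lt.mpr hx2)

variable {m a σ ηφ C s r' : ℝ}

/-- `μ > 0` outside the horizons: with `a² = 𝔪² − s²`, `s ≥ 0` (so `r₊ = 𝔪 + s`), every `r > r₊` has `μ(r) = (r−𝔪)² − s² > 0`.
[cite: Hintz2026WavesII, eqs. (4.2)-(4.3) TeX l.4037-4046 (reproduced; module 76 `mu_eq_sq_sub`)] -/
theorem mu_pos_of_gt (hs : 0 ≤ s) (has : s ^ 2 + a ^ 2 = m ^ 2) {ρ : ℝ} (hρ : m + s < ρ) : 0 < mu m a ρ := by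
  rw [mu_eq_sq_sub has]
  have h1 : s < ρ - m := by linarith
  nlinarith

/-- Lemma 4.12's first step on a fibre with POSITIVE Carter value: `Φ⁰(r) ≤ 0`, i.e. `C ≤ A²/μ`, forces `A ≠ 0` (since `C > 0`;
[AF] argues from `B² ≤ 𝒞 ≤ μ⁻¹A²` to the zero section — on `Γ₀` one has `𝒞 > 0` by Lemma 4.14, module 76 `carterC_pos`).
[cite: Hintz2026WavesII, proof of Lemma 4.12 TeX l.4543-4544 (reproduced in the form used here); Hintz2026WavesII, Lemma 4.14 TeX l.4623 ('𝒞 > 0 on Γ₀')] -/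
theorem Afn_ne_zero_of_Phi0_nonpos (hC : 0 < C) {ρ : ℝ} (hΦ : Phi0 m a σ ηφ C ρ ≤ 0) :
    Afn a ρ σ ηφ ≠ 0 := by
  intro hA
  simp only [Phi0, Vfn, hA] at hΦ
  have : (0:ℝ) ^ 2 / mu m a ρ = 0 := by simp
  linarith

/-- **(4.38) `EqTs3bOPhiSign` for the Kerr potential, for every `a² ≤ 𝔪²`**: on a fibre with Carter value `C > 0`, if
`Φ⁰` has a double zero at `r' > r₊ = 𝔪 + s` ((4.37): `Φ⁰(r') = 0`, `Ψ(r') = 0`), then `Φ⁰(r) < 0` for all `r > r₊`, `r ≠ r'`.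
Ingredients: `∂_rΦ⁰ = −Ψ/μ²`, `∂_r²Φ⁰ = d2Phi` (module 76/78, certified derivatives) and Lemma 4.12 (module 76 `d2Phi_neg`:
`Ψ = 0`, `A ≠ 0`, `r > 𝔪 ≥ 0`, `a² ≤ 𝔪²`, `μ > 0` ⇒ `∂_r²Φ⁰ < 0`), fed into `neg_off_double_zero`.
[cite: Hintz2026WavesII, eqs. (4.37)-(4.38) `EqTs3bOPhiDouble`/`EqTs3bOPhiSign` TeX l.4561-4570 (reproduced); Dyatlov2015, §3.2 Case 2 (held arXiv text p.17)] -/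
theorem Phi0_neg_of_ne (hm : 0 ≤ m) (hs : 0 ≤ s) (has : s ^ 2 + a ^ 2 = m ^ 2) (hC : 0 < C)
    (hr' : m + s < r') (h0 : Phi0 m a σ ηφ C r' = 0) (h1 : Psi m a r' σ ηφ = 0)
    {ρ : ℝ} (hρ : m + s < ρ) (hne : ρ ≠ r') : Phi0 m a σ ηφ C ρ < 0 := by
  have ha : a ^ 2 ≤ m ^ 2 := by nlinarith
  have hμ : ∀ x, m + s < x → mu m a x ≠ 0 := fun x hx => (mu_pos_of_gt hs has hx).ne'
  refine neg_off_double_zero (f := fun x => Phi0 m a σ ηφ C x) (f' := fun x => dPhi0 m a σ ηφ x)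
    (f'' := fun x => d2Phi m a x σ ηφ) (b := m + s)
    (fun x hx => hasDerivAt_Phi0 m a σ ηφ C x (hμ x hx)) (fun x hx => hasDerivAt_dPhi0 m a σ ηφ x (hμ x hx))
    ?_ hr' h0 ((dPhi0_eq_zero_iff m a σ ηφ r' (hμ r' hr')).mpr h1) ρ hρ hne
  intro x hx hΦ hd
  have hμx := mu_pos_of_gt hs has hx
  have hΨ : Psi m a x σ ηφ = 0 := (dPhi0_eq_zero_iff m a σ ηφ x hμx.ne').mp hd
  exact d2Phi_neg m a x σ ηφ hm (by linarith) ha hμx hΨ (Afn_ne_zero_of_Phi0_nonpos hC hΦ)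

/-- "(which is then necessarily unique)" ([AF] l.4650) / Dyatlov "`r'` is the only solution to the equation `Φ(r) = 0`": a fibre
carries AT MOST ONE trapped radius — any zero of `Φ⁰` in `(r₊, ∞)` is `r'`.
[cite: Hintz2026WavesII, TeX l.4650 (reproduced); Dyatlov2015, §3.2 Prop. 3.5 (held arXiv text Prop. 2.5 p.17: 'r′ is the only solution to the equation Φ(r) = 0')] -/
theorem trapped_radius_unique (hm : 0 ≤ m) (hs : 0 ≤ s) (has : s ^ 2 + a ^ 2 = m ^ 2) (hC : 0 < C)
    (hr' : m + s < r') (h0 : Phi0 m a σ ηφ C r' = 0) (h1 : Psi m a r' σ ηφ = 0)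
    {ρ : ℝ} (hρ : m + s < ρ) (hΦ : Phi0 m a σ ηφ C ρ = 0) : ρ = r' := by
  by_contra hne
  exact absurd hΦ (Phi0_neg_of_ne hm hs has hC hr' h0 h1 hρ hne).ne

end GlobalSign

/-! ## 3. [AF] (4.39)–(4.40) and Def. 4.15: the zero set `Σ_{(z,ζ)} = Γ^u ∪ Γ^s`, `Γ^u ∩ Γ^s = {(r', 0)}`, and the escape sign -/

section Branches

variable (m a σ ηφ C r' ρ ξ : ℝ)

/-- The radicand `u(r) := −Φ⁰(r)/μ(r)` of (4.39)/(4.47) (`= ξ²` on the characteristic set, by `𝒢⁰ = 0`).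
[cite: Hintz2026WavesII, eq. (4.39) `EqTs3bOGammapm0` TeX l.4576 and l.4529 ('Φ⁰ is equal to −μξ² on π∘γ'; transcription)] -/
def uFn (m a σ ηφ C ρ : ℝ) : ℝ := -Phi0 m a σ ηφ C ρ / mu m a ρ

/-- The graph function of the unstable branch: `g(r) := sgn(r − r')√(−Φ⁰(r)/μ(r))` ("we take the *positive* square root"), so
that (4.39) reads `Γ^u = {ξ = g(r)}`, `Γ^s = {ξ = −g(r)}`.
[cite: Hintz2026WavesII, eq. (4.39) `EqTs3bOGammapm0` TeX l.4571-4578 (transcription); Dyatlov2015, §3.2 Case 2 (held arXiv text p.17: 'Γ⁰_± = {ξ_r = ∓sgn(τ⁰)sgn(r − r′)√(Φ⁰(r)/Δ_r(r))}')] -/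
def brU (m a σ ηφ C r' ρ : ℝ) : ℝ := Real.sign (ρ - r') * Real.sqrt (uFn m a σ ηφ C ρ)

/-- **Def. 4.17 / (4.47), unstable**: `φ₀^u(r, ξ) := ξ − sgn(r − r')√(−Φ⁰(r)/μ(r))` (top sign), a defining function of `Γ^u`.
[cite: Hintz2026WavesII, Def. 4.17 `DefTs3bODefFn` eq. (4.47) `EqTs3bODefFn` TeX l.4688-4696 (transcription); Dyatlov2015, §3.2 (held arXiv text p.17: 'φ̃_± = ξ_r ∓ sgn(∂_τG)sgn(r − r′)√(Φ/Δ_r)')] -/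
def phiU (m a σ ηφ C r' ρ ξ : ℝ) : ℝ := ξ - brU m a σ ηφ C r' ρ

/-- **Def. 4.17 / (4.47), stable**: `φ₀^s(r, ξ) := ξ + sgn(r − r')√(−Φ⁰(r)/μ(r))` (bottom sign).
[cite: Hintz2026WavesII, Def. 4.17 `DefTs3bODefFn` eq. (4.47) TeX l.4688-4696 (transcription)] -/
def phiS (m a σ ηφ C r' ρ ξ : ℝ) : ℝ := ξ + brU m a σ ηφ C r' ρ

/-- `g(r') = 0` (`sgn 0 = 0`): both branches pass through `(r', 0)`. [cite: Hintz2026WavesII, TeX l.4579 ('Γ^u ∩ Γ^s = {(r′,0)}'; reproduced)] -/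
theorem brU_at_rprime : brU m a σ ηφ C r' r' = 0 := by
  simp [brU, Real.sign_zero]

/-- `φ₀^u + φ₀^s = 2ξ` — the identity used twice in the proof of Lemma 4.18 ("`H(φ₀^{u/s} + φ₀^{s/u}) = H(2ξ)`",
"`∓φ₀^{u/s} = ∓(φ₀^{u/s} + φ₀^{s/u}) = ∓2ξ` on `Γ₀^{s/u}`"). [cite: Hintz2026WavesII, proof of Lemma 4.18 TeX l.4730, l.4732 (reproduced)] -/
theorem phiU_add_phiS : phiU m a σ ηφ C r' ρ ξ + phiS m a σ ηφ C r' ρ ξ = 2 * ξ := by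
  simp only [phiU, phiS]; ring

/-- `g² = −Φ⁰/μ` wherever `Φ⁰ ≤ 0 < μ` and `r ≠ r'` (`sgn² = 1`). [cite: Hintz2026WavesII, eq. (4.39) TeX l.4576 (reproduced)] -/
theorem brU_sq (hne : ρ ≠ r') (hμ : 0 < mu m a ρ) (hΦ : Phi0 m a σ ηφ C ρ ≤ 0) :
    brU m a σ ηφ C r' ρ ^ 2 = -Phi0 m a σ ηφ C ρ / mu m a ρ := by
  have hnn : 0 ≤ -Phi0 m a σ ηφ C ρ / mu m a ρ := div_nonneg (by linarith) hμ.le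
  rw [brU, uFn, mul_pow, sign_sq_eq_one (sub_ne_zero.mpr hne), one_mul, Real.sq_sqrt hnn]

/-- **`μ·φ₀^u·φ₀^s = 𝒢⁰`** on `{r > r₊}` of a trapped fibre (`Φ⁰ ≤ 0`, `μ > 0`, and `Φ⁰(r') = 0` for the point `r = r'` where
`sgn = 0`): the zero set of `𝒢⁰` is the union of the two graphs, (4.39) "`Σ_{(z⁰,ζ⁰)} = Γ^u ∪ Γ^s`", and "Directly from
the definitions, `Γ₀ = Γ₀^u ∩ Γ₀^s`" (l.4662–4665). [cite: Hintz2026WavesII, eq. (4.39) `EqTs3bOGammapm0` TeX l.4571-4578 and TeX l.4662-4665 (reproduced)] -/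
theorem mu_mul_phiU_mul_phiS (hμ : 0 < mu m a ρ) (hΦ : Phi0 m a σ ηφ C ρ ≤ 0) (h0 : Phi0 m a σ ηφ C r' = 0) :
    mu m a ρ * (phiU m a σ ηφ C r' ρ ξ * phiS m a σ ηφ C r' ρ ξ) = sG0 m a σ ηφ C ρ ξ := by
  have hprod : phiU m a σ ηφ C r' ρ ξ * phiS m a σ ηφ C r' ρ ξ = ξ ^ 2 - brU m a σ ηφ C r' ρ ^ 2 := by
    simp only [phiU, phiS]; ring
  rw [hprod]
  rcases eq_or_ne ρ r' with rfl | hne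
  · rw [brU_at_rprime]; simp [sG0, h0]
  · rw [brU_sq m a σ ηφ C r' ρ hne hμ hΦ, sG0]
    field_simp
    ring

/-- **(4.39)**: on a trapped fibre, a point `(r, ξ)` with `r > r₊` lies on the characteristic set `{𝒢⁰ = 0}` iff it lies on
`Γ^u = {φ₀^u = 0}` or on `Γ^s = {φ₀^s = 0}`. [cite: Hintz2026WavesII, eq. (4.39) `EqTs3bOGammapm0` TeX l.4571-4578 (reproduced)] -/
theorem onSigma_iff (hμ : 0 < mu m a ρ) (hΦ : Phi0 m a σ ηφ C ρ ≤ 0) (h0 : Phi0 m a σ ηφ C r' = 0) :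
    sG0 m a σ ηφ C ρ ξ = 0 ↔ (phiU m a σ ηφ C r' ρ ξ = 0 ∨ phiS m a σ ηφ C r' ρ ξ = 0) := by
  rw [← mu_mul_phiU_mul_phiS m a σ ηφ C r' ρ ξ hμ hΦ h0, mul_eq_zero, mul_eq_zero]
  exact ⟨fun h => h.resolve_left hμ.ne', fun h => Or.inr h⟩

/-- `u = −Φ⁰/μ > 0` where `Φ⁰ < 0 < μ`. [cite: Hintz2026WavesII, eq. (4.39) TeX l.4576 (reproduced)] -/
theorem uFn_pos (hμ : 0 < mu m a ρ) (hΦ : Phi0 m a σ ηφ C ρ < 0) : 0 < uFn m a σ ηφ C ρ :=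
  div_pos (by linarith) hμ

/-- `g(r) ≠ 0` for `r ≠ r'` where `Φ⁰(r) < 0 < μ(r)` (by (4.38) this is all of `(r₊,∞) ∖ {r'}`).
[cite: Hintz2026WavesII, TeX l.4579 (reproduced)] -/
theorem brU_ne_zero (hne : ρ ≠ r') (hμ : 0 < mu m a ρ) (hΦ : Phi0 m a σ ηφ C ρ < 0) : brU m a σ ηφ C r' ρ ≠ 0 := by
  refine mul_ne_zero ?_ (Real.sqrt_pos.mpr (uFn_pos m a σ ηφ C ρ hμ hΦ)).ne'
  exact fun h => hne (sub_eq_zero.mp (Real.sign_eq_zero_iff.mp h))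

/-- **"`Γ^u ∩ Γ^s = {(r', 0)}`"** (l.4579), given (4.38) on the fibre (`Φ⁰ < 0` off `r'`): `φ₀^u = φ₀^s = 0` iff `(r, ξ) = (r', 0)`.
[cite: Hintz2026WavesII, TeX l.4579 and l.4662-4665 ('Γ₀ = Γ₀^u ∩ Γ₀^s'; reproduced)] -/
theorem phiU_phiS_zero_iff (hμ : 0 < mu m a ρ) (hneg : ρ ≠ r' → Phi0 m a σ ηφ C ρ < 0) :
    (phiU m a σ ηφ C r' ρ ξ = 0 ∧ phiS m a σ ηφ C r' ρ ξ = 0) ↔ (ρ = r' ∧ ξ = 0) := by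
  constructor
  · rintro ⟨hu, hs⟩
    have hξ : ξ = 0 := by
      have := phiU_add_phiS m a σ ηφ C r' ρ ξ
      rw [hu, hs] at this
      linarith
    refine ⟨?_, hξ⟩
    by_contra hne
    have hb : brU m a σ ηφ C r' ρ = 0 := by simp only [phiU, hξ, zero_sub, neg_eq_zero] at hu; exact hu
    exact brU_ne_zero m a σ ηφ C r' ρ hne hμ (hneg hne) hb
  · rintro ⟨rfl, rfl⟩
    simp [phiU, phiS, brU_at_rprime]

/-- **(4.40) `EqTs3bOGammapmFlow`**: on `Γ^u ∖ {(r',0)}`, `(r − r')·H_{𝒢⁰}r = 2μξ(r − r') = 2μ|r − r'|√(−Φ⁰/μ) > 0` — future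
integral curves on the unstable branch move AWAY from `r'` ("escape to `r = r₊` or `r = ∞`"), with the sign reversed on `Γ^s`.
[cite: Hintz2026WavesII, eq. (4.40) `EqTs3bOGammapmFlow` TeX l.4580-4584 (reproduced: the identity and the sign; the escape itself is dynamics)] -/
theorem escape_sign_unstable (hne : ρ ≠ r') (hμ : 0 < mu m a ρ) (hΦ : Phi0 m a σ ηφ C ρ < 0)
    (hξ : ξ = brU m a σ ηφ C r' ρ) :
    (ρ - r') * HGr m a ρ ξ = 2 * mu m a ρ * |ρ - r'| * Real.sqrt (uFn m a σ ηφ C ρ) ∧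
      0 < (ρ - r') * HGr m a ρ ξ := by
  have habs : Real.sign (ρ - r') * (ρ - r') = |ρ - r'| := by
    rcases lt_or_gt_of_ne (sub_ne_zero.mpr hne) with h | h
    · rw [Real.sign_of_neg h, abs_of_neg h]; ring
    · rw [Real.sign_of_pos h, abs_of_pos h]; ring
  have hid : (ρ - r') * HGr m a ρ ξ = 2 * mu m a ρ * |ρ - r'| * Real.sqrt (uFn m a σ ηφ C ρ) := by
    rw [hξ, HGr, brU, ← habs]; ring
  refine ⟨hid, ?_⟩
  rw [hid]
  have := Real.sqrt_pos.mpr (uFn_pos m a σ ηφ C ρ hμ hΦ)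
  have := abs_pos.mpr (sub_ne_zero.mpr hne)
  positivity

/-- (4.40), stable branch: `(r − r')·H_{𝒢⁰}r = −2μ|r − r'|√(−Φ⁰/μ) < 0` on `Γ^s ∖ {(r',0)}` (future curves tend TO `r'`).
[cite: Hintz2026WavesII, eq. (4.40) TeX l.4580-4584 ('with the sign reversed on Γ^s'; reproduced)] -/
theorem escape_sign_stable (hne : ρ ≠ r') (hμ : 0 < mu m a ρ) (hΦ : Phi0 m a σ ηφ C ρ < 0)
    (hξ : ξ = -brU m a σ ηφ C r' ρ) : (ρ - r') * HGr m a ρ ξ < 0 := by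
  have h := (escape_sign_unstable m a σ ηφ C r' ρ (brU m a σ ηφ C r' ρ) hne hμ hΦ rfl).2
  have : (ρ - r') * HGr m a ρ ξ = -((ρ - r') * HGr m a ρ (brU m a σ ηφ C r' ρ)) := by
    rw [hξ]; simp only [HGr]; ring
  rw [this]; linarith

/-- **"Γ₀ = Γ₀^u ∩ Γ₀^s"** (l.4662–4665) against Def. 4.13's printed triple `(ξ, Ψ, G_3b) = 0` (module 76 `OnGamma0`), on a trapped
fibre of a subextremal-or-extremal Kerr (`a² = 𝔪² − s²`, `s ≥ 0`, `C > 0`, `r > r₊`): `φ₀^u = φ₀^s = 0` ⟺ `ξ = 0 ∧ Ψ = 0 ∧ 𝒢⁰ = 0`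
⟺ `(r, ξ) = (r', 0)`. [cite: Hintz2026WavesII, TeX l.4662-4665 and Def. 4.13 l.4607-4613 / l.4626 (reproduced); Dyatlov2015, §3.2 Prop. 3.5 (held arXiv text Prop. 2.5 p.17: 'their intersection is equal to the set K̃')] -/
theorem gamma0_fibre {s : ℝ} (hm : 0 ≤ m) (hs : 0 ≤ s) (has : s ^ 2 + a ^ 2 = m ^ 2) (hC : 0 < C)
    (hr' : m + s < r') (h0 : Phi0 m a σ ηφ C r' = 0) (h1 : Psi m a r' σ ηφ = 0) (hρ : m + s < ρ) :
    (phiU m a σ ηφ C r' ρ ξ = 0 ∧ phiS m a σ ηφ C r' ρ ξ = 0) ↔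
      (ξ = 0 ∧ Psi m a ρ σ ηφ = 0 ∧ sG0 m a σ ηφ C ρ ξ = 0) := by
  have hμ := mu_pos_of_gt hs has hρ
  rw [phiU_phiS_zero_iff m a σ ηφ C r' ρ ξ hμ (fun hne => Phi0_neg_of_ne hm hs has hC hr' h0 h1 hρ hne)]
  constructor
  · rintro ⟨rfl, rfl⟩
    exact ⟨rfl, h1, by simp [sG0, h0]⟩
  · rintro ⟨rfl, -, hG⟩
    have hΦ : Phi0 m a σ ηφ C ρ = 0 := by simpa [sG0] using hG
    exact ⟨trapped_radius_unique hm hs has hC hr' h0 h1 hρ hΦ, rfl⟩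

end Branches

/-! ## 4. "The sets `Γ₀^{u/s}` are invariant under the `H_{G_3b}`-flow" (l.4666) in infinitesimal form: `H_{𝒢⁰}φ₀^{s} = 0` on
`Γ^s`, `H_{𝒢⁰}φ₀^{u} = 0` on `Γ^u`, and the printed step "at `Γ₀^{s}`, `Hφ₀^u = H(φ₀^u + φ₀^s) = H(2ξ) = −2μ'ξ² + 2Ψ/μ²`" -/

section Invariance

variable (m a σ ηφ C r' ρ ξ : ℝ)

/-- `u' = ∂_r(−Φ⁰/μ) = (−∂_rΦ⁰·μ + Φ⁰·μ')/μ²`. [cite: Hintz2026WavesII, eq. (4.47) TeX l.4691-4694 (the r-derivative of its radicand, computed here)] -/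
def duFn (m a σ ηφ C ρ : ℝ) : ℝ :=
  (-dPhi0 m a σ ηφ ρ * mu m a ρ + Phi0 m a σ ηφ C ρ * dmu m ρ) / mu m a ρ ^ 2

/-- `u = −Φ⁰/μ` is differentiable off `{μ = 0}` with derivative `duFn`. [cite: Hintz2026WavesII, eq. (4.47) TeX l.4691-4694 (computed here)] -/
theorem hasDerivAt_uFn (hμ : mu m a ρ ≠ 0) : HasDerivAt (fun x => uFn m a σ ηφ C x) (duFn m a σ ηφ C ρ) ρ := by
  unfold uFn duFn
  refine (((hasDerivAt_Phi0 m a σ ηφ C ρ hμ).fun_neg).fun_div (hasDerivAt_mu m a ρ) hμ).congr_deriv ?_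
  field_simp
  ring

/-- `∂_r g = sgn(r − r')·u'/(2√u)` off `r = r'` (where `sgn` is locally constant).
[cite: Hintz2026WavesII, eq. (4.47) TeX l.4691-4694 and l.4745 ('2∂_rφ₀^s'; the r-derivative of the branch function, computed here)] -/
def dbrU (m a σ ηφ C r' ρ : ℝ) : ℝ :=
  Real.sign (ρ - r') * (duFn m a σ ηφ C ρ / (2 * Real.sqrt (uFn m a σ ηφ C ρ)))

/-- The branch function `g = sgn(r−r')√u` is differentiable at every `r ≠ r'` with `u(r) ≠ 0`, `μ(r) ≠ 0`, with derivative `dbrU`.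
[cite: Hintz2026WavesII, TeX l.4579 ('the submanifolds Γ^{u/s} are smooth (in fact, analytic)'; the derivative off r′ computed here)] -/
theorem hasDerivAt_brU_of_ne (hne : ρ ≠ r') (hμ : mu m a ρ ≠ 0) (hu : uFn m a σ ηφ C ρ ≠ 0) :
    HasDerivAt (fun x => brU m a σ ηφ C r' x) (dbrU m a σ ηφ C r' ρ) ρ := by
  have hsq : HasDerivAt (fun x => Real.sign (ρ - r') * Real.sqrt (uFn m a σ ηφ C x))
      (dbrU m a σ ηφ C r' ρ) ρ := by
    unfold dbrU
    exact ((hasDerivAt_uFn m a σ ηφ C ρ hμ).sqrt hu).const_mul _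
  refine hsq.congr_of_eventuallyEq ?_
  rcases lt_or_gt_of_ne hne with h | h
  · filter_upwards [Iio_mem_nhds h] with x hx
    simp only [brU, Real.sign_of_neg (sub_neg.mpr hx), Real.sign_of_neg (sub_neg.mpr h)]
  · filter_upwards [Ioi_mem_nhds h] with x hx
    simp only [brU, Real.sign_of_pos (sub_pos.mpr hx), Real.sign_of_pos (sub_pos.mpr h)]

/-- **`H_{𝒢⁰}φ₀^s = 0` on `Γ^s ∖ {(r',0)}`**: with `H_{𝒢⁰} = (H r)∂_r + (H ξ)∂_ξ = 2μξ∂_r − (μ'ξ² − Ψ/μ²)∂_ξ` ((4.32), the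
`(r,ξ)`-part) and `φ₀^s = ξ + g(r)`: `(2μξ)·g'(r) + H ξ·1 = 0` at `ξ = −g(r)` (`r ≠ r'`, `Φ⁰(r) < 0 < μ(r)`) — the infinitesimal
form of "the sets `Γ₀^{u/s}` are invariant under the `H_{G_3b}`-flow" / "we have `H_{G_3b}φ₀^{u/s} = 0` at `Γ₀^{u/s}`" (l.4666,
l.4698), here COMPUTED rather than inferred from the flow. [cite: Hintz2026WavesII, TeX l.4666 and l.4698 (reproduced by direct computation); Dyatlov2015, §3.2 (held arXiv text p.17: 'Since H_G is tangent to Γ̃_±, we have H_G φ̃_± = 0 on Γ̃_±')] -/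
theorem HsG0_phiS_eq_zero (hne : ρ ≠ r') (hμ : 0 < mu m a ρ) (hΦ : Phi0 m a σ ηφ C ρ < 0)
    (hξ : ξ = -brU m a σ ηφ C r' ρ) :
    HGr m a ρ ξ * dbrU m a σ ηφ C r' ρ + HGxi m a ρ σ ξ ηφ * 1 = 0 := by
  have hu := uFn_pos m a σ ηφ C ρ hμ hΦ
  have hq0 : Real.sqrt (uFn m a σ ηφ C ρ) ≠ 0 := (Real.sqrt_pos.mpr hu).ne'
  have hq2 : Real.sqrt (uFn m a σ ηφ C ρ) ^ 2 = -Phi0 m a σ ηφ C ρ / mu m a ρ := by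
    rw [Real.sq_sqrt hu.le, uFn]
  have hS2 : Real.sign (ρ - r') ^ 2 = 1 := sign_sq_eq_one (sub_ne_zero.mpr hne)
  subst hξ
  have hμ0 := hμ.ne'
  -- reduce to the radicand: `(2μξ)g' = −μu'·sgn²`, `ξ² = sgn²u`
  have h1 : HGr m a ρ (-brU m a σ ηφ C r' ρ) * dbrU m a σ ηφ C r' ρ =
      -(mu m a ρ * duFn m a σ ηφ C ρ) * Real.sign (ρ - r') ^ 2 := by
    simp only [HGr, brU, dbrU]
    field_simp
  have h2 : HGxi m a ρ σ (-brU m a σ ηφ C r' ρ) ηφ =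
      -(dmu m ρ * (Real.sign (ρ - r') ^ 2 * Real.sqrt (uFn m a σ ηφ C ρ) ^ 2) - Psi m a ρ σ ηφ / mu m a ρ ^ 2) := by
    simp only [HGxi, brU]; ring
  rw [mul_one, h1, h2, hS2, hq2]
  simp only [duFn, dPhi0]
  field_simp
  ring

/-- Likewise **`H_{𝒢⁰}φ₀^u = 0` on `Γ^u ∖ {(r',0)}`** (`φ₀^u = ξ − g(r)`, `ξ = g(r)`). [cite: Hintz2026WavesII, TeX l.4666, l.4698 (reproduced by direct computation)] -/
theorem HsG0_phiU_eq_zero (hne : ρ ≠ r') (hμ : 0 < mu m a ρ) (hΦ : Phi0 m a σ ηφ C ρ < 0)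
    (hξ : ξ = brU m a σ ηφ C r' ρ) :
    HGr m a ρ ξ * (-dbrU m a σ ηφ C r' ρ) + HGxi m a ρ σ ξ ηφ * 1 = 0 := by
  have h := HsG0_phiS_eq_zero m a σ ηφ C r' ρ (-ξ) hne hμ hΦ (by rw [hξ])
  have e1 : HGr m a ρ (-ξ) = -HGr m a ρ ξ := by simp only [HGr]; ring
  have e2 : HGxi m a ρ σ (-ξ) ηφ = HGxi m a ρ σ ξ ηφ := by simp only [HGxi]; ring
  rw [e1, e2] at h
  linarith

/-- **The printed step of Lemma 4.18's proof (l.4728–4731)**: "at `Γ₀^{s}`, we have `H_{G_3b}φ₀^{u} = H_{G_3b}(φ₀^u + φ₀^s) =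
H_{G_3b}(2ξ) = −2μ'ξ² + 2Ψ/μ²`" — on `Γ^s ∖ {(r',0)}` the value of `H_{𝒢⁰}φ₀^u = (2μξ)·(−g') + Hξ` IS `2·Hξ = −2μ'ξ² + 2Ψ/μ²`
(module 78 `HG_two_xi`), because `Hφ₀^s = 0` there. [cite: Hintz2026WavesII, proof of Lemma 4.18 TeX l.4728-4731 (reproduced)] -/
theorem HsG0_phiU_on_GammaS (hne : ρ ≠ r') (hμ : 0 < mu m a ρ) (hΦ : Phi0 m a σ ηφ C ρ < 0)
    (hξ : ξ = -brU m a σ ηφ C r' ρ) :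
    HGr m a ρ ξ * (-dbrU m a σ ηφ C r' ρ) + HGxi m a ρ σ ξ ηφ * 1 =
      -(2 * dmu m ρ * ξ ^ 2) + 2 * Psi m a ρ σ ηφ / mu m a ρ ^ 2 := by
  have h := HsG0_phiS_eq_zero m a σ ηφ C r' ρ ξ hne hμ hΦ hξ
  rw [← HG_two_xi]
  linarith

/-- … and on `Γ^s`, "`∓φ₀^{u} = ∓(φ₀^u + φ₀^s) = ∓2ξ = 2sgn(r − r')√(−Φ⁰/μ)`": `−φ₀^u(r, −g(r)) = 2g(r)`.
[cite: Hintz2026WavesII, proof of Lemma 4.18 TeX l.4732 (reproduced)] -/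
theorem neg_phiU_on_GammaS (hξ : ξ = -brU m a σ ηφ C r' ρ) : -phiU m a σ ηφ C r' ρ ξ = 2 * brU m a σ ηφ C r' ρ := by
  rw [hξ, phiU]; ring

end Invariance

/-! ## 5. [AF] (4.51) `EqTs3bOnuSqrt` at the trapped radius: `sgn(r − r')√(−Φ⁰/μ) = c·(r − r') + o(r − r')` with
`c = √(−∂_r²Φ⁰(r')/(2μ(r')))` — the branch function is differentiable AT `r'` with slope `c`, and `2μ(r')c = σν` -/

section Slope

variable (m a σ ηφ C r' : ℝ)

/-- **The slope `c := √((−∂_r²Φ⁰/(2μ))|_{r=r'})`** of (4.51) — the tangent slope of `Γ^u` at `(r', 0)` (and `−c` that of `Γ^s`).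
[cite: Hintz2026WavesII, eq. (4.51) `EqTs3bOnuSqrt` TeX l.4733-4737 (transcription of the coefficient)] -/
def slopeC (m a σ ηφ r' : ℝ) : ℝ := Real.sqrt (-d2Phi m a r' σ ηφ / (2 * mu m a r'))

/-- `μ = r² − 2𝔪r + a²` is continuous in `r` (polynomial). [cite: Hintz2026WavesII, eq. (4.2) `EqTsBLFunc` TeX l.4039 (continuity of the printed polynomial; proved here)] -/
theorem continuous_mu : Continuous fun x => mu m a x := by unfold mu; fun_prop

/-- `μ' = 2r − 2𝔪` is continuous in `r`. [cite: Hintz2026WavesII, eq. (4.2) TeX l.4039 (proved here)] -/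
theorem continuous_dmu : Continuous fun x => dmu m x := by unfold dmu; fun_prop

/-- `Ψ = −A(4rμσ + Aμ')` is continuous in `r` (polynomial). [cite: Hintz2026WavesII, eq. (4.31) `EqTs3bOPsi` TeX l.4471 (continuity of the printed polynomial; proved here)] -/
theorem continuous_Psi : Continuous fun x => Psi m a x σ ηφ := by unfold Psi Afn dmu mu; fun_prop

/-- Taylor to second order at the double zero, as a limit: `Φ⁰(r)/(r − r')² → ½∂_r²Φ⁰(r')` as `r → r'` (`Φ⁰(r') = 0`, `Ψ(r') = 0`,
`μ(r') ≠ 0`; l'Hôpital on the certified derivatives). [cite: Hintz2026WavesII, proof of Lemma 4.18 TeX l.4732-4737 ('expanding Φ⁰ in Taylor series around its local non-degenerate maximum'; reproduced)] -/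
theorem tendsto_Phi0_div_sq (hμ : mu m a r' ≠ 0) (h0 : Phi0 m a σ ηφ C r' = 0) (h1 : Psi m a r' σ ηφ = 0) :
    Tendsto (fun x => Phi0 m a σ ηφ C x / (x - r') ^ 2) (𝓝[≠] r') (𝓝 (d2Phi m a r' σ ηφ / 2)) := by
  have hμev : ∀ᶠ x in 𝓝 r', mu m a x ≠ 0 := (continuous_mu m a).continuousAt.eventually_ne hμ
  have hd0 : dPhi0 m a σ ηφ r' = 0 := (dPhi0_eq_zero_iff m a σ ηφ r' hμ).mpr h1
  refine HasDerivAt.lhopital_zero_nhdsNE (f' := fun x => dPhi0 m a σ ηφ x) (g' := fun x => 2 * (x - r')) ?_ ?_ ?_ ?_ ?_ ?_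
  · exact eventually_nhdsWithin_of_eventually_nhds (hμev.mono fun x hx => hasDerivAt_Phi0 m a σ ηφ C x hx)
  · refine Eventually.of_forall fun x => ?_
    exact (((hasDerivAt_id' (x := x)).sub_const r').fun_pow 2).congr_deriv (by simp)
  · filter_upwards [self_mem_nhdsWithin] with x hx
    exact mul_ne_zero two_ne_zero (sub_ne_zero.mpr hx)
  · have hc : ContinuousAt (fun x => Phi0 m a σ ηφ C x) r' := (hasDerivAt_Phi0 m a σ ηφ C r' hμ).continuousAt
    have := hc.tendsto
    rw [h0] at this
    exact tendsto_nhdsWithin_of_tendsto_nhds this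
  · have : Tendsto (fun x : ℝ => (x - r') ^ 2) (𝓝 r') (𝓝 ((r' - r') ^ 2)) :=
      ((continuous_id.sub continuous_const).pow 2).continuousAt.tendsto
    rw [sub_self, zero_pow two_ne_zero] at this
    exact tendsto_nhdsWithin_of_tendsto_nhds this
  · have hsl := (hasDerivAt_dPhi0 m a σ ηφ r' hμ).tendsto_slope
    rw [slope_fun_def_field] at hsl
    simp only [hd0, sub_zero] at hsl
    have := hsl.div_const 2
    refine this.congr' (Eventually.of_forall fun x => ?_)
    simp only
    rw [div_div]
    ring_nf

/-- Hence `u(r)/(r − r')² = −Φ⁰(r)/(μ(r)(r − r')²) → −∂_r²Φ⁰(r')/(2μ(r')) = c²`. [cite: Hintz2026WavesII, eq. (4.51) TeX l.4733-4737 (reproduced)] -/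
theorem tendsto_uFn_div_sq (hμ : mu m a r' ≠ 0) (h0 : Phi0 m a σ ηφ C r' = 0) (h1 : Psi m a r' σ ηφ = 0) :
    Tendsto (fun x => uFn m a σ ηφ C x / (x - r') ^ 2) (𝓝[≠] r') (𝓝 (-d2Phi m a r' σ ηφ / (2 * mu m a r'))) := by
  have h := tendsto_Phi0_div_sq m a σ ηφ C r' hμ h0 h1
  have hmu : Tendsto (fun x => mu m a x) (𝓝[≠] r') (𝓝 (mu m a r')) :=
    tendsto_nhdsWithin_of_tendsto_nhds (continuous_mu m a).continuousAt.tendsto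
  have := (h.neg).div hmu hμ
  refine (this.congr' (Eventually.of_forall fun x => ?_)).trans ?_
  · simp only [Pi.div_apply, uFn]; ring
  · rw [show -(d2Phi m a r' σ ηφ / 2) / mu m a r' = -d2Phi m a r' σ ηφ / (2 * mu m a r') by ring]

/-- Off `r = r'`: `g(r) = (r − r')·√(u(r)/(r − r')²)` (since `sgn(r−r')/(r−r') = 1/|r−r'|` and `√((r−r')²) = |r−r'|`).
[cite: Hintz2026WavesII, eq. (4.51) TeX l.4733-4737 ('√(−Φ⁰/μ) = √(…)(r − r′)sgn(r − r′) + …'; reproduced)] -/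
theorem brU_eq_mul_sqrt {ρ : ℝ} (hne : ρ ≠ r') :
    brU m a σ ηφ C r' ρ = (ρ - r') * Real.sqrt (uFn m a σ ηφ C ρ / (ρ - r') ^ 2) := by
  have hρ : ρ - r' ≠ 0 := sub_ne_zero.mpr hne
  rw [brU, Real.sqrt_div' _ (sq_nonneg _), Real.sqrt_sq_eq_abs, ← self_div_abs_eq_sign hρ]
  field_simp

/-- **(4.51) as a derivative**: the branch function `g(r) = sgn(r − r')√(−Φ⁰(r)/μ(r))` (so `φ₀^{u/s} = ξ ∓ g`) is differentiable
AT the trapped radius with `g'(r') = c = √((−∂_r²Φ⁰/(2μ))|_{r'})` — [AF]'s "`√(−Φ⁰/μ) = √((−∂_r²Φ⁰/(2μ))|_{r'})(r − r')sgn(r − r')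
+ 𝒪((r − r')²)`", in the form used (`μ(r') ≠ 0`, `Φ⁰(r') = Ψ(r') = 0`).  In particular `Γ^u` and `Γ^s` have the tangent
directions `(1, c)` and `(1, −c)` at `(r', 0)`: they "intersect transversally at `(r', 0)`" once `c ≠ 0` (Lemma 4.16(2)).
[cite: Hintz2026WavesII, eq. (4.51) `EqTs3bOnuSqrt` TeX l.4733-4737 (reproduced as a HasDerivAt statement); Hintz2026WavesII, Lemma 4.16(2) TeX l.4673 and l.4681 ('transversality being a consequence of the fact that Φ⁰ has a non-degenerate maximum'); Dyatlov2015, §3.2 (held arXiv text p.17: 'Γ⁰_± are smooth one-dimensional submanifolds … intersecting transversely at (r′, 0)')] -/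
theorem hasDerivAt_brU_rprime (hμ : mu m a r' ≠ 0) (h0 : Phi0 m a σ ηφ C r' = 0) (h1 : Psi m a r' σ ηφ = 0) :
    HasDerivAt (fun x => brU m a σ ηφ C r' x) (slopeC m a σ ηφ r') r' := by
  rw [hasDerivAt_iff_tendsto_slope, slope_fun_def_field]
  have hlim := (tendsto_uFn_div_sq m a σ ηφ C r' hμ h0 h1).sqrt
  refine (hlim.congr' ?_)
  filter_upwards [self_mem_nhdsWithin] with x hx
  have hx' : x - r' ≠ 0 := sub_ne_zero.mpr hx
  rw [brU_at_rprime, sub_zero, brU_eq_mul_sqrt m a σ ηφ C r' hx]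
  field_simp

/-- `c ≥ 0`; `c² = −∂_r²Φ⁰(r')/(2μ(r'))` when the radicand is non-negative. [cite: Hintz2026WavesII, eq. (4.51) TeX l.4735 (reproduced)] -/
theorem slopeC_sq (h : 0 ≤ -d2Phi m a r' σ ηφ / (2 * mu m a r')) :
    slopeC m a σ ηφ r' ^ 2 = -d2Phi m a r' σ ηφ / (2 * mu m a r') := Real.sq_sqrt h

/-- **`c > 0` at every trapped radius of a Kerr with `a² ≤ 𝔪²`** (`r' > 𝔪 ≥ 0`, `μ(r') > 0`, `Ψ(r') = 0`, `A(r') ≠ 0`): by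
Lemma 4.12 (module 76 `d2Phi_neg`).  This is the transversality of `Γ^u ⋔ Γ^s` at `Γ₀` (Lemma 4.16(2)) and the non-vanishing
"`{φ₀^u, φ₀^s} = 2√(−(∂_r²Φ⁰/2μ)) ≠ 0`" of Lemma 4.18. [cite: Hintz2026WavesII, Lemma 4.16(2) TeX l.4673/4681 and Lemma 4.18 TeX l.4717, l.4743-4747 (reproduced)] -/
theorem slopeC_pos (hm : 0 ≤ m) (hmr : m < r') (ha : a ^ 2 ≤ m ^ 2) (hμ : 0 < mu m a r') (h1 : Psi m a r' σ ηφ = 0)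
    (hA : Afn a r' σ ηφ ≠ 0) : 0 < slopeC m a σ ηφ r' := by
  have hd : d2Phi m a r' σ ηφ < 0 := d2Phi_neg m a r' σ ηφ hm hmr ha hμ h1 hA
  unfold slopeC
  apply Real.sqrt_pos.mpr
  apply div_pos (by linarith)
  positivity

/-- **`2μ(r')·c = σ·ν`** with `ν = √(ν²)`, `ν² = σ⁻²(−2μ∂_r²Φ⁰)` of (4.49) (module 78 `nuSq`): the slope of the branches and the
expansion rate are the same datum (`μ(r') > 0`, `σ > 0`; no sign condition on `∂_r²Φ⁰` is needed since both sides are then `0`).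
[cite: Hintz2026WavesII, eq. (4.49) `EqTs3bOnuExpr` TeX l.4708-4711 with (4.51) l.4735 (the relation, computed here)] -/
theorem two_mu_mul_slopeC (hμ : 0 < mu m a r') (hσ : 0 < σ) :
    2 * mu m a r' * slopeC m a σ ηφ r' = σ * Real.sqrt (nuSq m a r' σ ηφ) := by
  rcases le_or_gt (d2Phi m a r' σ ηφ) 0 with hd | hd
  · -- both radicands are non-negative: compare squares
    have hrad1 : 0 ≤ -d2Phi m a r' σ ηφ / (2 * mu m a r') := div_nonneg (by linarith) (by positivity)
    have hrad2 : 0 ≤ nuSq m a r' σ ηφ := by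
      unfold nuSq
      exact div_nonneg (by nlinarith [hμ]) (sq_nonneg _)
    have hl : 0 ≤ 2 * mu m a r' * slopeC m a σ ηφ r' := by unfold slopeC; positivity
    have hr : 0 ≤ σ * Real.sqrt (nuSq m a r' σ ηφ) := by positivity
    refine (sq_eq_sq₀ hl hr).mp ?_
    rw [mul_pow, slopeC_sq m a σ ηφ r' hrad1, mul_pow _ (Real.sqrt _), Real.sq_sqrt hrad2, nuSq]
    field_simp
  · -- `∂_r²Φ⁰ > 0`: both sides vanish (truncated square roots)
    have hl : slopeC m a σ ηφ r' = 0 := by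
      unfold slopeC
      apply Real.sqrt_eq_zero'.mpr
      exact div_nonpos_of_nonpos_of_nonneg (by linarith) (by positivity)
    have hr : Real.sqrt (nuSq m a r' σ ηφ) = 0 := by
      apply Real.sqrt_eq_zero'.mpr
      unfold nuSq
      apply div_nonpos_of_nonpos_of_nonneg _ (sq_nonneg _)
      nlinarith [hμ]
    rw [hl, hr, mul_zero, mul_zero]

end Slope

/-! ## 6. [AF] Lemma 4.18 `LemmaTs3bOnu`, THE DERIVATION of (4.49): the limit "of `(H_{G_3b}φ₀^{u})/(−φ₀^{u})` at `Γ₀` along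
`Γ₀^{s}`" IS `σ⁻¹√(−2μ(r')∂_r²Φ⁰(r'))`; Dyatlov's route `∂_{ξ}(Hφ₀^u)|_{Γ₀}` gives the same number; and
`{φ₀^u, φ₀^s}|_{Γ₀} = 2c ≠ 0` -/

section ExpansionRate

variable (m a σ ηφ C r' : ℝ)

/-- [AF]'s quotient along the stable branch: `Q(r) := σ⁻¹·(H_{G_3b}φ₀^u)/(−φ₀^u)` evaluated at the point `(r, −g(r)) ∈ Γ^s`, with
the printed values `H_{G_3b}φ₀^u = −2μ'ξ² + 2Ψ/μ²` (l.4730; `HsG0_phiU_on_GammaS`) and `−φ₀^u = 2g(r)` (l.4732; `neg_phiU_on_GammaS`).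
[cite: Hintz2026WavesII, proof of Lemma 4.18 TeX l.4728-4732 and eq. (4.48) `EqTs3bOnu` l.4699-4702 ('(σ⁻¹H_{G_3b}φ₀^{u/s})|_Σ = ∓ν^{u/s}φ₀^{u/s}'; transcription of the quotient whose limit is taken)] -/
def afQuot (m a σ ηφ C r' ρ : ℝ) : ℝ :=
  σ⁻¹ * ((-(2 * dmu m ρ * brU m a σ ηφ C r' ρ ^ 2) + 2 * Psi m a ρ σ ηφ / mu m a ρ ^ 2) / (2 * brU m a σ ηφ C r' ρ))

/-- The quotient rewritten with `g(r) = (r − r')G(r)`, `G(r) := √(u/(r−r')²)`: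
`Q(r) = σ⁻¹(−μ'(r)(r − r')G(r) + (Ψ(r)/(r − r'))/(μ(r)²G(r)))` (`r ≠ r'`, `g(r) ≠ 0`).
[cite: Hintz2026WavesII, proof of Lemma 4.18 TeX l.4732-4741 (the two terms '−2μ′ξ²' → 0 and '2Ψ/μ²' ~ '2μ⁻²∂_rΨ(r′)(r − r′)'; reproduced)] -/
theorem afQuot_eq {ρ : ℝ} (hne : ρ ≠ r') (hg : brU m a σ ηφ C r' ρ ≠ 0) :
    afQuot m a σ ηφ C r' ρ = σ⁻¹ * (-(dmu m ρ * ((ρ - r') * Real.sqrt (uFn m a σ ηφ C ρ / (ρ - r') ^ 2))) +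
      Psi m a ρ σ ηφ / (ρ - r') / (mu m a ρ ^ 2 * Real.sqrt (uFn m a σ ηφ C ρ / (ρ - r') ^ 2))) := by
  have hG : Real.sqrt (uFn m a σ ηφ C ρ / (ρ - r') ^ 2) ≠ 0 := by
    intro h
    apply hg
    rw [brU_eq_mul_sqrt m a σ ηφ C r' hne, h, mul_zero]
  have hρ : ρ - r' ≠ 0 := sub_ne_zero.mpr hne
  rw [afQuot, brU_eq_mul_sqrt m a σ ηφ C r' hne]
  congr 1
  field_simp

variable {m a σ ηφ C r'} {s : ℝ}

/-- **Lemma 4.18, (4.48) ⇒ (4.49)**: on a trapped fibre of a Kerr black hole with `a² = 𝔪² − s² ≤ 𝔪²` (Carter value `C > 0`,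
trapped radius `r' > r₊ = 𝔪 + s`, `σ > 0` as on `Σ⁺`), [AF]'s quotient `σ⁻¹(H_{G_3b}φ₀^u)/(−φ₀^u)` along `Γ^s` CONVERGES, as
`r → r'`, to `ν := √(ν²)`, `ν² = σ⁻²(−2μ(r')∂_r²Φ⁰(r'))` — i.e. the expansion rate defined dynamically by (4.48) is the number
(4.49) (module 78 `nuSq`, whose closed form on `Γ₀` is `16r((r−𝔪)³ + 𝔪(𝔪²−a²))/(r−𝔪)²`).  Ingredients exactly as printed:
`ξ²/(∓φ₀) → 0`, (4.51), `2Ψ/μ² = 2μ⁻²∂_rΨ(r')(r − r') + …`, `2μ⁻²∂_rΨ = −2∂_r²Φ⁰` at `r'`.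
[cite: Hintz2026WavesII, Lemma 4.18 `LemmaTs3bOnu` eq. (4.49) `EqTs3bOnuExpr` TeX l.4705-4718 and its proof l.4728-4741 (reproduced as a limit theorem); Dyatlov2015, §3.2 eq. before Prop. 3.7 (held arXiv text (e:tilde-nu) p.17: 'ν̃ = √(−2Δ_r∂_r²G_r)/|∂_τG|')] -/
theorem tendsto_afQuot (hm : 0 ≤ m) (hs : 0 ≤ s) (has : s ^ 2 + a ^ 2 = m ^ 2) (hC : 0 < C)
    (hr' : m + s < r') (h0 : Phi0 m a σ ηφ C r' = 0) (h1 : Psi m a r' σ ηφ = 0) (hσ : 0 < σ) :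
    Tendsto (fun ρ => afQuot m a σ ηφ C r' ρ) (𝓝[≠] r') (𝓝 (Real.sqrt (nuSq m a r' σ ηφ))) := by
  have hμ := mu_pos_of_gt hs has hr'
  have ha : a ^ 2 ≤ m ^ 2 := by nlinarith
  have hA : Afn a r' σ ηφ ≠ 0 := Afn_ne_zero_of_Phi0_nonpos hC (le_of_eq h0)
  have hmr : m < r' := by linarith
  have hc := slopeC_pos m a σ ηφ r' hm hmr ha hμ h1 hA
  set c := slopeC m a σ ηφ r' with hcdef
  set G : ℝ → ℝ := fun ρ => Real.sqrt (uFn m a σ ηφ C ρ / (ρ - r') ^ 2) with hGdef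
  -- the pieces
  have hG : Tendsto G (𝓝[≠] r') (𝓝 c) := (tendsto_uFn_div_sq m a σ ηφ C r' hμ.ne' h0 h1).sqrt
  have hdmu : Tendsto (fun ρ => dmu m ρ) (𝓝[≠] r') (𝓝 (dmu m r')) :=
    tendsto_nhdsWithin_of_tendsto_nhds (continuous_dmu m).continuousAt.tendsto
  have hsub : Tendsto (fun ρ : ℝ => ρ - r') (𝓝[≠] r') (𝓝 0) := by
    have : Tendsto (fun ρ : ℝ => ρ - r') (𝓝 r') (𝓝 (r' - r')) :=
      (continuous_id.sub continuous_const).continuousAt.tendsto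
    rw [sub_self] at this
    exact tendsto_nhdsWithin_of_tendsto_nhds this
  have hmu2 : Tendsto (fun ρ => mu m a ρ ^ 2) (𝓝[≠] r') (𝓝 (mu m a r' ^ 2)) :=
    tendsto_nhdsWithin_of_tendsto_nhds (((continuous_mu m a).pow 2).continuousAt.tendsto)
  have hPsi : Tendsto (fun ρ => Psi m a ρ σ ηφ / (ρ - r')) (𝓝[≠] r')
      (𝓝 (dPsiFormal m a r' σ (Afn a r' σ ηφ))) := by
    have h := (hasDerivAt_Psi m a r' σ ηφ).tendsto_slope
    rw [slope_fun_def_field] at h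
    simpa [h1] using h
  -- assemble: σ⁻¹ (−μ'·(ρ−r')·G + (Ψ/(ρ−r'))/(μ²G)) → σ⁻¹ (0 + Ψ'/(μ² c))
  have hlim : Tendsto (fun ρ => σ⁻¹ * (-(dmu m ρ * ((ρ - r') * G ρ)) +
      Psi m a ρ σ ηφ / (ρ - r') / (mu m a ρ ^ 2 * G ρ))) (𝓝[≠] r')
      (𝓝 (σ⁻¹ * (-(dmu m r' * (0 * c)) + dPsiFormal m a r' σ (Afn a r' σ ηφ) / (mu m a r' ^ 2 * c)))) := by
    refine Tendsto.const_mul _ (Tendsto.add (hdmu.mul (hsub.mul hG)).neg (hPsi.div (hmu2.mul hG) ?_))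
    exact mul_ne_zero (pow_ne_zero 2 hμ.ne') hc.ne'
  -- the limit value is √(ν²)
  have hval : σ⁻¹ * (-(dmu m r' * (0 * c)) + dPsiFormal m a r' σ (Afn a r' σ ηφ) / (mu m a r' ^ 2 * c)) =
      Real.sqrt (nuSq m a r' σ ηφ) := by
    have hν2 : nuSq m a r' σ ηφ = 2 * dPsiFormal m a r' σ (Afn a r' σ ηφ) / (mu m a r' * σ ^ 2) :=
      nuSq_eq m a r' σ ηφ hμ.ne' hσ.ne' h1
    have hνpos : 0 < nuSq m a r' σ ηφ := nuSq_pos m a r' σ ηφ hm hmr ha hμ hσ.ne' h1 hA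
    have hsq : 0 < Real.sqrt (nuSq m a r' σ ηφ) := Real.sqrt_pos.mpr hνpos
    have h2μc : 2 * mu m a r' * c = σ * Real.sqrt (nuSq m a r' σ ηφ) := two_mu_mul_slopeC m a σ ηφ r' hμ hσ
    -- c = σ√ν²/(2μ); Ψ' = ν² μ σ²/2
    have hc' : c = σ * Real.sqrt (nuSq m a r' σ ηφ) / (2 * mu m a r') := by
      rw [← h2μc]; field_simp
    have hΨ' : dPsiFormal m a r' σ (Afn a r' σ ηφ) = nuSq m a r' σ ηφ * (mu m a r' * σ ^ 2) / 2 := by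
      rw [hν2]; field_simp
    rw [zero_mul, mul_zero, neg_zero, zero_add, hc', hΨ']
    have hs2 : Real.sqrt (nuSq m a r' σ ηφ) ^ 2 = nuSq m a r' σ ηφ := Real.sq_sqrt hνpos.le
    field_simp
    nlinarith [hs2]
  rw [← hval]
  refine hlim.congr' ?_
  -- eventually (on r > r₊, r ≠ r') the quotient has this form
  have hIoi : ∀ᶠ ρ in 𝓝[≠] r', m + s < ρ := eventually_nhdsWithin_of_eventually_nhds (Ioi_mem_nhds hr')
  filter_upwards [hIoi, self_mem_nhdsWithin] with ρ hρ hne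
  have hμρ := mu_pos_of_gt hs has hρ
  have hΦ := Phi0_neg_of_ne hm hs has hC hr' h0 h1 hρ hne
  exact (afQuot_eq m a σ ηφ C r' hne (brU_ne_zero m a σ ηφ C r' ρ hne hμρ hΦ)).symm

/-- **Lemma 4.18, final claim**: "`{φ₀^u, φ₀^s} = H_{φ₀^u}φ₀^s = … = 2H_ξφ₀^s = 2∂_rφ₀^s = 2√(−(∂_r²Φ⁰/2μ)|_{r'})`, which is indeed
nonzero" — with `φ₀^u = ξ − g`, `φ₀^s = ξ + g`: `{φ₀^u, φ₀^s} = ∂_ξφ₀^u·∂_rφ₀^s − ∂_rφ₀^u·∂_ξφ₀^s = 1·g' − (−g')·1 = 2g'`, and at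
`r = r'` the certified `g'(r') = c` (`hasDerivAt_brU_rprime`): the bracket is `2c`, POSITIVE for `a² ≤ 𝔪²` (`slopeC_pos`).
[cite: Hintz2026WavesII, Lemma 4.18 TeX l.4717 ('{φ₀^u, φ₀^s}|_{Γ₀} is everywhere non-zero') and its proof l.4743-4747 (reproduced)] -/
theorem poisson_phiU_phiS_rprime (hm : 0 ≤ m) (hmr : m < r') (ha : a ^ 2 ≤ m ^ 2) (hμ : 0 < mu m a r')
    (h0 : Phi0 m a σ ηφ C r' = 0) (h1 : Psi m a r' σ ηφ = 0) (hA : Afn a r' σ ηφ ≠ 0) (ξ : ℝ) :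
    HasDerivAt (fun x => phiS m a σ ηφ C r' x ξ) (slopeC m a σ ηφ r') r' ∧
      HasDerivAt (fun x => phiU m a σ ηφ C r' x ξ) (-slopeC m a σ ηφ r') r' ∧
      (1 : ℝ) * slopeC m a σ ηφ r' - (-slopeC m a σ ηφ r') * 1 = 2 * slopeC m a σ ηφ r' ∧
      0 < 2 * slopeC m a σ ηφ r' := by
  have hg := hasDerivAt_brU_rprime m a σ ηφ C r' hμ.ne' h0 h1
  refine ⟨?_, ?_, by ring, by linarith [slopeC_pos m a σ ηφ r' hm hmr ha hμ h1 hA]⟩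
  · exact (hg.const_add ξ).congr_deriv (by simp)
  · exact hg.const_sub ξ

/-- **Dyatlov's route to the same number** ("By calculating `∂_{ξ_r}H_Gφ̃_±|_{K̃}`, we find `ν̃_+ = ν̃_− = ν̃`"): at the trapped
radius, `H_{𝒢⁰}φ₀^u = (2μξ)·(−g'(r')) + Hξ` as a function of `ξ` (with the certified `g'(r') = c`) has `ξ`-derivative `−2μ(r')c`
at `ξ = 0`; and `−σ⁻¹·(−2μ(r')c) = 2μc/σ = ν` — the same `√(ν²)` (`σ > 0`, `μ(r') > 0`).
[cite: Dyatlov2015, §3.2 (held arXiv text p.17: 'By calculating ∂_{ξ_r}H_G φ̃_±|_{K̃}, we find ν̃_+|_{K̃} = ν̃_−|_{K̃} = ν̃ … (e:tilde-nu)'; reproduced in [AF]'s normalisation (4.48)); Hintz2026WavesII, eq. (4.48)-(4.49) TeX l.4699-4711] -/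
theorem dyatlov_rate (hμ : 0 < mu m a r') (hσ : 0 < σ) :
    HasDerivAt (fun x => HGr m a r' x * (-slopeC m a σ ηφ r') + HGxi m a r' σ x ηφ * 1)
        (-(2 * mu m a r' * slopeC m a σ ηφ r')) 0 ∧
      -(σ⁻¹ * (-(2 * mu m a r' * slopeC m a σ ηφ r'))) = Real.sqrt (nuSq m a r' σ ηφ) := by
  refine ⟨?_, ?_⟩
  · have h1 : HasDerivAt (fun x => HGr m a r' x * (-slopeC m a σ ηφ r'))
        (2 * mu m a r' * (-slopeC m a σ ηφ r')) 0 := by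
      unfold HGr
      exact (((hasDerivAt_const (0:ℝ) (2 * mu m a r')).fun_mul (hasDerivAt_id' (x := (0:ℝ)))).mul_const _).congr_deriv
        (by ring)
    have h2 : HasDerivAt (fun x => HGxi m a r' σ x ηφ * 1) 0 0 := by
      unfold HGxi
      exact ((((hasDerivAt_const (0:ℝ) (dmu m r')).fun_mul ((hasDerivAt_id' (x := (0:ℝ))).fun_pow 2)).fun_sub
        (hasDerivAt_const (0:ℝ) (Psi m a r' σ ηφ / mu m a r' ^ 2))).fun_neg.mul_const 1).congr_deriv (by simp)
    exact (h1.add h2).congr_deriv (by ring)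
  · rw [two_mu_mul_slopeC m a σ ηφ r' hμ hσ]
    field_simp

end ExpansionRate

/-! ## 7. The hyperbolic fixed point (computed here from (4.32)/(4.34)): at `(r', 0)` the planar field `(H r, H ξ) = (2μξ, −(μ'ξ² +
∂_rΦ⁰))` vanishes, its Jacobian is `J = [[0, 2μ(r')], [−∂_r²Φ⁰(r'), 0]]`, `J² = (σν)²·1`, and `J(1, ±c) = ±σν·(1, ±c)`:
the tangent lines of `Γ^{u}`/`Γ^{s}` are the expanding/contracting eigen-directions with exponents `±σν` (in `𝔱`-time `±ν̃`) -/

section FixedPoint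

variable (m a σ ηφ C r' ρ ξ : ℝ)

/-- "`H_{𝒢⁰}|_{(r',0)} = 0`" — the field `(2μξ, −(μ'ξ² − Ψ/μ²))` vanishes at `(r', 0)` iff `Ψ(r') = 0` (`μ ≠ 0`): trapped points
are fixed points of the `(r, ξ)`-flow. [cite: Hintz2026WavesII, TeX l.4579 ('Note also that H_{𝒢⁰}|_{(r′,0)} = 0, and hence … are trapped'; reproduced)] -/
theorem field_zero_iff (hμ : mu m a r' ≠ 0) :
    (HGr m a r' 0 = 0 ∧ HGxi m a r' σ 0 ηφ = 0) ↔ Psi m a r' σ ηφ = 0 := by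
  rw [(HG2r_at_xi_zero m a r' σ ηφ hμ).1]
  simp only [HGr, mul_zero, true_and]
  rw [div_eq_zero_iff]
  exact ⟨fun h => h.resolve_right (pow_ne_zero 2 hμ), fun h => Or.inl h⟩

/-- `∂_r(H r) = ∂_r(2μξ) = 2μ'ξ`. [cite: Hintz2026WavesII, eq. (4.32) TeX l.4479 (partial derivative computed here)] -/
theorem hasDerivAt_HGr_r : HasDerivAt (fun x => HGr m a x ξ) (2 * dmu m ρ * ξ) ρ := by
  unfold HGr
  exact (((hasDerivAt_const ρ (2:ℝ)).fun_mul (hasDerivAt_mu m a ρ)).mul_const ξ).congr_deriv (by ring)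

/-- `∂_ξ(H r) = 2μ`. [cite: Hintz2026WavesII, eq. (4.32) TeX l.4479 (computed here)] -/
theorem hasDerivAt_HGr_xi : HasDerivAt (fun x => HGr m a ρ x) (2 * mu m a ρ) ξ := by
  unfold HGr
  exact (((hasDerivAt_const ξ (2 * mu m a ρ)).fun_mul (hasDerivAt_id' (x := ξ)))).congr_deriv (by ring)

/-- `∂_r(H ξ) = ∂_r(−μ'ξ² − ∂_rΦ⁰) = −2ξ² − ∂_r²Φ⁰` (`μ'' = 2`; `μ ≠ 0`). [cite: Hintz2026WavesII, eq. (4.32) TeX l.4479 with l.4549 ('μ″ = 2') (computed here)] -/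
theorem hasDerivAt_HGxi_r (hμ : mu m a ρ ≠ 0) :
    HasDerivAt (fun x => HGxi m a x σ ξ ηφ) (-(2 * ξ ^ 2) - d2Phi m a ρ σ ηφ) ρ := by
  have h : HasDerivAt (fun x => -(dmu m x * ξ ^ 2) - dPhi0 m a σ ηφ x) (-(2 * ξ ^ 2) - d2Phi m a ρ σ ηφ) ρ :=
    (((hasDerivAt_dmu m ρ).mul_const (ξ ^ 2)).fun_neg.fun_sub (hasDerivAt_dPhi0 m a σ ηφ ρ hμ)).congr_deriv (by ring)
  refine h.congr_of_eventuallyEq (Eventually.of_forall fun x => ?_)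
  simp only [HGxi, dPhi0]; ring

/-- `∂_ξ(H ξ) = −2μ'ξ`. [cite: Hintz2026WavesII, eq. (4.32) TeX l.4479 (computed here)] -/
theorem hasDerivAt_HGxi_xi : HasDerivAt (fun x => HGxi m a ρ σ x ηφ) (-(2 * dmu m ρ * ξ)) ξ := by
  unfold HGxi
  exact ((((hasDerivAt_const ξ (dmu m ρ)).fun_mul ((hasDerivAt_id' (x := ξ)).fun_pow 2)).fun_sub
    (hasDerivAt_const ξ (Psi m a ρ σ ηφ / mu m a ρ ^ 2))).fun_neg).congr_deriv (by simp; ring)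

/-- **The Jacobian of `(H r, H ξ)` at the fixed point `(r', 0)`**: `J = [[∂_r H r, ∂_ξ H r], [∂_r H ξ, ∂_ξ H ξ]]|_{(r',0)} =
[[0, 2μ(r')], [−∂_r²Φ⁰(r'), 0]]` (the four certified partials above at `ξ = 0`).
[cite: Hintz2026WavesII, eqs. (4.32)/(4.34) TeX l.4479, l.4522 (the linearisation at (r′,0), computed here); Hintz2026WavesII, Prop. 4.19(2) eq. (4.53) `EqTs3bONHypNorm` TeX l.4775-4779 (the exponential rates this matrix models)] -/
def linJac (m a σ ηφ r' : ℝ) : Matrix (Fin 2) (Fin 2) ℝ := !![0, 2 * mu m a r'; -d2Phi m a r' σ ηφ, 0]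

/-- The four entries of `linJac` ARE the certified partial derivatives of `(H r, H ξ)` at `(r', 0)` (`μ(r') ≠ 0`).
[cite: Hintz2026WavesII, eqs. (4.32)/(4.34) TeX l.4479, l.4522 (the linearisation at (r′,0), computed here)] -/
theorem linJac_entries (hμ : mu m a r' ≠ 0) :
    HasDerivAt (fun x => HGr m a x 0) (linJac m a σ ηφ r' 0 0) r' ∧
      HasDerivAt (fun x => HGr m a r' x) (linJac m a σ ηφ r' 0 1) 0 ∧
      HasDerivAt (fun x => HGxi m a x σ 0 ηφ) (linJac m a σ ηφ r' 1 0) r' ∧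
      HasDerivAt (fun x => HGxi m a r' σ x ηφ) (linJac m a σ ηφ r' 1 1) 0 := by
  refine ⟨?_, ?_, ?_, ?_⟩
  · simpa [linJac] using hasDerivAt_HGr_r m a r' 0
  · simpa [linJac] using hasDerivAt_HGr_xi m a r' 0
  · simpa [linJac] using hasDerivAt_HGxi_r m a σ ηφ r' 0 hμ
  · simpa [linJac] using hasDerivAt_HGxi_xi m a σ ηφ r' 0

/-- `tr J = 0`, `det J = 2μ(r')∂_r²Φ⁰(r')` — negative at a trapped radius (`a² ≤ 𝔪²`): a SADDLE.
[cite: Hintz2026WavesII, TeX l.4579-4584 (the 'unstable'/'stable' picture, Figure 4.2; computed here)] -/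
theorem linJac_trace_det :
    (linJac m a σ ηφ r').trace = 0 ∧ (linJac m a σ ηφ r').det = 2 * mu m a r' * d2Phi m a r' σ ηφ := by
  constructor
  · simp [linJac, Matrix.trace, Fin.sum_univ_two]
  · rw [linJac, Matrix.det_fin_two_of]; ring

/-- `det J = 2μ(r')∂_r²Φ⁰(r') < 0` at a trapped radius of a Kerr with `a² ≤ 𝔪²` (`r' > 𝔪 ≥ 0`, `μ(r') > 0`, `Ψ(r') = 0`, `A(r') ≠ 0`):
the fixed point `(r', 0)` is a hyperbolic SADDLE, by Lemma 4.12 (module 76 `d2Phi_neg`).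
[cite: Hintz2026WavesII, Lemma 4.12 `LemmaTs3bOConv` TeX l.4539-4559 and TeX l.4579-4584 (the unstable/stable picture; the determinant computed here)] -/
theorem linJac_det_neg (hm : 0 ≤ m) (hmr : m < r') (ha : a ^ 2 ≤ m ^ 2) (hμ : 0 < mu m a r')
    (h1 : Psi m a r' σ ηφ = 0) (hA : Afn a r' σ ηφ ≠ 0) : (linJac m a σ ηφ r').det < 0 := by
  rw [(linJac_trace_det m a σ ηφ r').2]
  have hd : d2Phi m a r' σ ηφ < 0 := d2Phi_neg m a r' σ ηφ hm hmr ha hμ h1 hA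
  nlinarith

/-- **`J² = (σν)²·1`**: `J² = −2μ∂_r²Φ⁰·1 = σ²ν²·1` (module 78 `nuSq = σ⁻²(−2μ∂_r²Φ⁰)`, `σ ≠ 0`) — the eigenvalues of the
linearisation are `±σν`, i.e. `∓ν` is exactly the rate in (4.48) "`σ⁻¹Hφ₀^{u/s} = ∓ν φ₀^{u/s}`".
[cite: Hintz2026WavesII, eq. (4.48)-(4.49) TeX l.4699-4711 (the rates as eigenvalues of the linearised (r,ξ)-flow, computed here)] -/
theorem linJac_sq (hσ : σ ≠ 0) :
    linJac m a σ ηφ r' * linJac m a σ ηφ r' = (σ ^ 2 * nuSq m a r' σ ηφ) • (1 : Matrix (Fin 2) (Fin 2) ℝ) := by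
  have hν : σ ^ 2 * nuSq m a r' σ ηφ = -(2 * mu m a r' * d2Phi m a r' σ ηφ) := by
    rw [nuSq]; field_simp
  rw [hν]
  ext i j
  fin_cases i <;> fin_cases j <;>
    simp [linJac, Matrix.mul_apply, Fin.sum_univ_two, Matrix.smul_apply, mul_comm, mul_assoc]

/-- **The eigen-directions are the tangents of the branches**: with `c = g'(r')` (§5), `J(1, c) = 2μ(r')c·(1, c)` and
`J(1, −c) = −2μ(r')c·(1, −c)`, and `2μ(r')c = σν`: the tangent line `T_{(r',0)}Γ^u = ℝ(1, c)` expands at rate `σν`, the line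
`T_{(r',0)}Γ^s = ℝ(1, −c)` contracts at rate `σν` (per unit `H_{G_3b}`-time divided by `σ`; radicand `−∂_r²Φ⁰/(2μ) ≥ 0`).
[cite: Hintz2026WavesII, Prop. 4.19(2) eq. (4.53) `EqTs3bONHypNorm` TeX l.4775-4779 and its proof l.4852-4865 ('ν̃^{u/s} = (σ/(H_{G_3b}𝔱))ν^{s/u} > 0', l.4863; the linear-algebra model computed here); Dyatlov2015, §3.2 (held arXiv text p.18: '∂_s(dφ̃^s v_±) = ±(ν̃∘φ̃^s)v_±')] -/
theorem linJac_eigen (h : 0 ≤ -d2Phi m a r' σ ηφ / (2 * mu m a r')) (hμ : mu m a r' ≠ 0) :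
    (linJac m a σ ηφ r').mulVec ![1, slopeC m a σ ηφ r'] =
        (2 * mu m a r' * slopeC m a σ ηφ r') • ![1, slopeC m a σ ηφ r'] ∧
      (linJac m a σ ηφ r').mulVec ![1, -slopeC m a σ ηφ r'] =
        (-(2 * mu m a r' * slopeC m a σ ηφ r')) • ![1, -slopeC m a σ ηφ r'] := by
  have hc2 : slopeC m a σ ηφ r' ^ 2 = -d2Phi m a r' σ ηφ / (2 * mu m a r') := slopeC_sq m a σ ηφ r' h
  have hkey : -d2Phi m a r' σ ηφ = 2 * mu m a r' * slopeC m a σ ηφ r' ^ 2 := by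
    rw [hc2]; field_simp
  constructor
  · ext i
    fin_cases i
    · simp [linJac, Matrix.mulVec, dotProduct, Fin.sum_univ_two]
    · simp [linJac, Matrix.mulVec, dotProduct, Fin.sum_univ_two]
      rw [hkey]; ring
  · ext i
    fin_cases i
    · simp [linJac, Matrix.mulVec, dotProduct, Fin.sum_univ_two]
    · simp [linJac, Matrix.mulVec, dotProduct, Fin.sum_univ_two]
      rw [hkey]; ring

/-- In `𝔱`-time (the rescaling `𝖧 = H_{G_3b}/(H_{G_3b}𝔱)` of "Trapping IV", `H_{G_3b}𝔱 = 2ϱ²g⁻¹(d𝔱,·) > 0`, module 78 `HGt`) the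
exponent `σν` becomes `σν/(H_{G_3b}𝔱) = ν̃`, module 78's `nuNormSq = σ²ν²/(H_{G_3b}𝔱)²` — [AF] l.4863 "`ν̃^{u/s} = (σ/(H_{G_3b}𝔱))ν^{s/u}`".
[cite: Hintz2026WavesII, proof of Prop. 4.19(2) TeX l.4852-4865 (reproduced: the normalisation identity); Hintz2026WavesII, TeX l.4752-4758 ('𝖧 := H_{G_3b}/(H_{G_3b}𝔱)')] -/
theorem rate_in_t_time (s2 : ℝ) (hν : 0 ≤ nuSq m a r' σ ηφ) :
    (σ * Real.sqrt (nuSq m a r' σ ηφ) / HGt m a r' s2 σ ηφ) ^ 2 = nuNormSq m a r' s2 σ ηφ := by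
  rw [nuNormSq, div_pow, mul_pow, Real.sq_sqrt hν]

end FixedPoint

/-! ## 8. On `Γ₀` itself (module 76 `OnGamma0`, module 78 `OnGamma0Pol`): every point of the trapped set of a Kerr black hole with
`a² ≤ 𝔪²`, in either chart (poles included), is a trapped fibre in the above sense — so (4.38)–(4.40), (4.47), (4.49), (4.51) and
the saddle hold there, with `ν² = 16r((r−𝔪)³ + 𝔪(𝔪²−a²))/(r−𝔪)²` -/

section OnTrappedSet

variable {m a s s2 σ ξ ηθ ηφ r' ω₁ ω₂ η₁ η₂ : ℝ}

/-- Boyer–Lindquist chart: a point of `Γ₀` (Def. 4.13: `ξ = 0`, `Ψ = 0`, `G_3b = 0`) lies on a fibre whose potential has the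
double zero (4.37) at its radius: `Φ⁰(r') = 0` (from `G_3b = μξ² + Φ⁰ = 0`, `ξ = 0`) and `∂_rΦ⁰(r') = 0` (`Ψ = 0`), with Carter
value `C = 𝒞(ζ)`. [cite: Hintz2026WavesII, Def. 4.13 TeX l.4607-4615 ('a point … lies in Γ₀ if and only if ξ = 0 and Φ⁰ … has a double zero at r', l.4615; reproduced)] -/
theorem trapped_fibre_of_onGamma0 (h0 : OnGamma0 m a r' s2 σ ξ ηθ ηφ) :
    Phi0 m a σ ηφ (carterC a s2 σ ηθ ηφ) r' = 0 ∧ Psi m a r' σ ηφ = 0 := by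
  obtain ⟨hξ, hΨ, hG⟩ := h0
  refine ⟨?_, hΨ⟩
  have h := sG0_eq_G3b m a σ ηφ r' ξ s2 ηθ
  rw [hG, sG0, hξ] at h
  simpa using h

/-- Polar chart (module 78, poles included): the same, with `η_ϕ = ω¹η₂ − ω²η₁` and the polynomial `𝒞` of (4.22).
[cite: Hintz2026WavesII, Def. 4.13 TeX l.4607-4615 with (4.21)-(4.22) l.4346-4361 (reproduced)] -/
theorem trapped_fibre_of_onGamma0Pol (h0 : OnGamma0Pol m a r' ω₁ ω₂ σ ξ η₁ η₂) :
    Phi0 m a σ (Lpol ω₁ ω₂ η₁ η₂) (carterCpol a ω₁ ω₂ σ η₁ η₂) r' = 0 ∧ Psi m a r' σ (Lpol ω₁ ω₂ η₁ η₂) = 0 := by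
  obtain ⟨hξ, hΨ, hG⟩ := h0
  refine ⟨?_, hΨ⟩
  have h := sG0_eq_sG_add m a σ (Lpol ω₁ ω₂ η₁ η₂) (carterCpol a ω₁ ω₂ σ η₁ η₂) r' ξ
  rw [← G3bpol, hG, sG0, hξ] at h
  simpa using h

/-- **THE ASSEMBLED STATEMENT ON `Γ₀` (Boyer–Lindquist chart, `0 < sin²θ ≤ 1`)**: at a point of `Γ₀ ∖ o` in the future half `Σ⁺`
of a Kerr black hole with `a² = 𝔪² − s²`, `s ≥ 0`, `r' > r₊ = 𝔪 + s`: (i) the fibre potential is negative off `r'` on `(r₊, ∞)`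
((4.38)); (ii) [AF]'s quotient `σ⁻¹Hφ₀^u/(−φ₀^u)` along `Γ^s` tends to `ν = √(ν²)` ((4.48) ⇒ (4.49)); (iii) `ν²` has module 78's
closed form `16r'((r'−𝔪)³ + 𝔪(𝔪²−a²))/(r'−𝔪)²` and is positive.  Inputs from module 76: `𝒞 > 0` (Lemma 4.14), `σ > 0` on `Σ⁺`
((4.42)), `A ≠ 0`. [cite: Hintz2026WavesII, Lemma 4.18 `LemmaTs3bOnu` TeX l.4705-4717 with (4.38)-(4.40), (4.47)-(4.51) (reproduced, assembled on Γ₀); Hintz2026WavesII, Prop. 6.3 `PropDyTr` TeX l.5788-5799, §9.1.2 TeX l.7888-7896 and §9.3.4 (Γ.1)-(Γ.3) TeX l.8883-8894 = the trapping hypotheses of Thm 9.16 `ThmSpHi` (where φ₀^{u/s}, ν^{u/s}, {φ^u, φ^s} > 0 are consumed); Hintz2026, Prop. 8.3 `PropWETr` TeX l.7395-7403 (the import site in the paper under audit)] -/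
theorem expansion_rate_on_Gamma0 (hm : 0 < m) (hs : 0 ≤ s) (has : s ^ 2 + a ^ 2 = m ^ 2) (hr' : m + s < r')
    (hs2 : 0 < s2) (hs21 : s2 ≤ 1) (h0 : OnGamma0 m a r' s2 σ ξ ηθ ηφ) (hne : ¬(σ = 0 ∧ ξ = 0 ∧ ηθ = 0 ∧ ηφ = 0))
    (hplus : InSigmaPlus m a r' s2 σ ηφ) :
    (∀ ρ, m + s < ρ → ρ ≠ r' → Phi0 m a σ ηφ (carterC a s2 σ ηθ ηφ) ρ < 0) ∧
      Tendsto (fun ρ => afQuot m a σ ηφ (carterC a s2 σ ηθ ηφ) r' ρ) (𝓝[≠] r')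
        (𝓝 (Real.sqrt (nuSq m a r' σ ηφ))) ∧
      nuSq m a r' σ ηφ = 16 * r' * ((r' - m) ^ 3 + m * (m ^ 2 - a ^ 2)) / (r' - m) ^ 2 ∧
      0 < nuSq m a r' σ ηφ := by
  have hμ := mu_pos_of_gt hs has hr'
  have hmr : m < r' := by linarith
  have hr0 : 0 < r' := by linarith
  have ha : a ^ 2 ≤ m ^ 2 := by nlinarith
  have hρ : 0 < rhoSq a r' s2 := by
    unfold rhoSq; nlinarith [mul_nonneg (sq_nonneg a) (sub_nonneg.mpr hs21)]
  have hC := carterC_pos hμ hs2 hρ h0.1 h0.2.2 hne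
  have hA := A_ne_zero hs2 hρ h0.1 h0.2.2 hne
  have hσ : 0 < σ := (sigma_pos_on_SigmaPlus hm hmr hμ hs2 hs21 hρ h0 hne).mp hplus
  obtain ⟨hΦ0, hΨ⟩ := trapped_fibre_of_onGamma0 h0
  refine ⟨fun ρ hρ' hne' => Phi0_neg_of_ne hm.le hs has hC hr' hΦ0 hΨ hρ' hne',
    tendsto_afQuot hm.le hs has hC hr' hΦ0 hΨ hσ,
    nuSq_closed_form m a r' σ ηφ hr0.ne' (ne_of_gt hmr) hμ.ne' hσ.ne' hΨ hA,
    nuSq_pos m a r' σ ηφ hm.le hmr ha hμ hσ.ne' hΨ hA⟩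

/-- **The same over the whole hemisphere of the polar chart, POLES INCLUDED** (`|ω|² < 1`; module 78's `OnGamma0Pol`,
`carterCpol_pos`, `sigma_pos_pol`, `A_ne_zero_pol`). [cite: Hintz2026WavesII, Lemma 4.18 TeX l.4705-4717 with (4.21)-(4.22) l.4346-4361 (reproduced, assembled on Γ₀ incl. the axis)] -/
theorem expansion_rate_on_Gamma0_pol (hm : 0 < m) (hs : 0 ≤ s) (has : s ^ 2 + a ^ 2 = m ^ 2) (hr' : m + s < r')
    (hu : normSq ω₁ ω₂ < 1) (h0 : OnGamma0Pol m a r' ω₁ ω₂ σ ξ η₁ η₂) (hne : ¬(σ = 0 ∧ ξ = 0 ∧ η₁ = 0 ∧ η₂ = 0))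
    (hplus : InSigmaPlus m a r' (normSq ω₁ ω₂) σ (Lpol ω₁ ω₂ η₁ η₂)) :
    (∀ ρ, m + s < ρ → ρ ≠ r' → Phi0 m a σ (Lpol ω₁ ω₂ η₁ η₂) (carterCpol a ω₁ ω₂ σ η₁ η₂) ρ < 0) ∧
      Tendsto (fun ρ => afQuot m a σ (Lpol ω₁ ω₂ η₁ η₂) (carterCpol a ω₁ ω₂ σ η₁ η₂) r' ρ) (𝓝[≠] r')
        (𝓝 (Real.sqrt (nuSq m a r' σ (Lpol ω₁ ω₂ η₁ η₂)))) ∧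
      nuSq m a r' σ (Lpol ω₁ ω₂ η₁ η₂) = 16 * r' * ((r' - m) ^ 3 + m * (m ^ 2 - a ^ 2)) / (r' - m) ^ 2 ∧
      0 < nuSq m a r' σ (Lpol ω₁ ω₂ η₁ η₂) := by
  have hμ := mu_pos_of_gt hs has hr'
  have hmr : m < r' := by linarith
  have hr0 : 0 < r' := by linarith
  have ha : a ^ 2 ≤ m ^ 2 := by nlinarith
  have hρ := rhoSq_pol_pos (a := a) hu hr0.ne'
  have hC := carterCpol_pos hμ hu hρ h0.1 h0.2.2 hne
  have hA := A_ne_zero_pol hu hρ h0.1 h0.2.2 hne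
  have hσ : 0 < σ := (sigma_pos_pol hm hmr hμ hu h0 hne).mp hplus
  obtain ⟨hΦ0, hΨ⟩ := trapped_fibre_of_onGamma0Pol h0
  refine ⟨fun ρ hρ' hne' => Phi0_neg_of_ne hm.le hs has hC hr' hΦ0 hΨ hρ' hne',
    tendsto_afQuot hm.le hs has hC hr' hΦ0 hΨ hσ,
    nuSq_closed_form m a r' σ _ hr0.ne' (ne_of_gt hmr) hμ.ne' hσ.ne' hΨ hA,
    nuSq_pos m a r' σ _ hm.le hmr ha hμ hσ.ne' hΨ hA⟩

end OnTrappedSet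

/-! ## 9. Two worked fibres in closed form (computed here; the first is Dyatlov's Prop. 3.8 at `Λ = 0`): SCHWARZSCHILD `a = 0` — every
fibre of `Γ₀` has `r' = 3𝔪`, `C = 27𝔪²σ²`, `Φ⁰(r) = −σ²(r − 3𝔪)²(r + 6𝔪)/(r − 2𝔪)`, slope `c = √3σ/𝔪`, rate `ν = 6√3𝔪` — and an
EXTREMAL fibre `a = 𝔪`, `η_ϕ = 𝔪σ`, `C = 16𝔪²σ²`, `r' = 2𝔪`: `Φ⁰(r) = −σ²(r − 2𝔪)²(r² + 4𝔪r − 4𝔪²)/(r − 𝔪)²`, `ν² = 32𝔪²` — the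
double zero (4.37) and the global sign (4.38) visible in the factorisation, with no analysis -/

section WorkedFibres

variable (m σ ηφ r : ℝ)

/-- Schwarzschild, `a = 0`: `Ψ = 2r⁴σ²(r − 3𝔪)` — so the only trapped radius is `r' = 3𝔪` (Dyatlov: "`Ψ = 0` is equivalent to
`r = 3M`"). [cite: Dyatlov2015, §3.3 Prop. 3.8 (held arXiv text Prop. 2.8 p.18: 'Ψ(r) = 2τr²(r−3M) … Ψ = 0 is equivalent to r = 3M'); Hintz2026WavesII, eq. (4.31) TeX l.4471 and TeX l.4879 ('on Schwarzschild, this is the set {|η| = 3√3𝔪}'; computed here)] -/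
theorem Psi_schwarzschild_factor : Psi m 0 r σ ηφ = 2 * r ^ 4 * σ ^ 2 * (r - 3 * m) := by
  simp only [Psi, Afn, mu, dmu]; ring

/-- Schwarzschild: the fibre potential with the photon-sphere Carter value `C = 27𝔪²σ²` FACTORISES as
`Φ⁰(r) = −σ²(r − 3𝔪)²(r + 6𝔪)/(r − 2𝔪)` (`r ≠ 2𝔪`): the double zero at `r' = 3𝔪` ((4.37)) and the sign (4.38) on
`r > 2𝔪 = r₊` are read off. [cite: Hintz2026WavesII, eqs. (4.34), (4.37)-(4.38) TeX l.4520-4524, l.4561-4570 (the Schwarzschild instance, computed here); Dyatlov2015, §3.3 Prop. 3.8 (held arXiv text p.18: 'K̃ = {ξ_r = 0, r = 3M, …, G_θ = 27M²τ²/(1−9ΛM²)}')] -/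
theorem Phi0_schwarzschild (hr : r ≠ 2 * m) :
    Phi0 m 0 σ ηφ (27 * m ^ 2 * σ ^ 2) r = -(σ ^ 2 * (r - 3 * m) ^ 2 * (r + 6 * m)) / (r - 2 * m) := by
  have hμ : mu m 0 r = r * (r - 2 * m) := by simp only [mu]; ring
  have h2 : r - 2 * m ≠ 0 := sub_ne_zero.mpr hr
  have hA : Afn 0 r σ ηφ = -(r ^ 2 * σ) := by simp only [Afn]; ring
  simp only [Phi0, Vfn, hA, hμ]
  field_simp
  ring

/-- Schwarzschild (4.38), EXPLICITLY: `Φ⁰(r) < 0` for `r > 2𝔪`, `r ≠ 3𝔪` (`𝔪 > 0`, `σ ≠ 0`) — from the factorisation.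
[cite: Hintz2026WavesII, eq. (4.38) `EqTs3bOPhiSign` TeX l.4567-4570 (Schwarzschild instance, computed here)] -/
theorem Phi0_schwarzschild_neg (hm : 0 < m) (hσ : σ ≠ 0) (hr : 2 * m < r) (hne : r ≠ 3 * m) :
    Phi0 m 0 σ ηφ (27 * m ^ 2 * σ ^ 2) r < 0 := by
  rw [Phi0_schwarzschild m σ ηφ r (ne_of_gt hr)]
  have h1 : 0 < σ ^ 2 * (r - 3 * m) ^ 2 * (r + 6 * m) := by
    have := sq_pos_of_ne_zero (sub_ne_zero.mpr hne)
    have := sq_pos_of_ne_zero hσ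
    have : 0 < r + 6 * m := by linarith
    positivity
  have h2 : 0 < r - 2 * m := by linarith
  rw [neg_div]
  exact neg_neg_of_pos (div_pos h1 h2)

/-- Schwarzschild: the trapped fibre data of this file at `r' = 3𝔪` — `Φ⁰(3𝔪) = 0`, `Ψ(3𝔪) = 0`, `μ(3𝔪) = 3𝔪²` (`𝔪 ≠ 0`).
[cite: Dyatlov2015, §3.3 Prop. 3.8 (held arXiv text p.18: 'Δ_r(3M) = 3M²(1−9ΛM²)'); Hintz2026WavesII, eq. (4.37) TeX l.4561-4565 (Schwarzschild instance, computed here)] -/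
theorem schwarzschild_trapped_fibre (hm : m ≠ 0) :
    Phi0 m 0 σ ηφ (27 * m ^ 2 * σ ^ 2) (3 * m) = 0 ∧ Psi m 0 (3 * m) σ ηφ = 0 ∧ mu m 0 (3 * m) = 3 * m ^ 2 := by
  refine ⟨?_, by rw [Psi_schwarzschild_factor]; ring, by simp only [mu]; ring⟩
  have h3 : (3 : ℝ) * m ≠ 2 * m := by intro h; apply hm; linarith
  rw [Phi0_schwarzschild m σ ηφ (3 * m) h3]
  simp

/-- Schwarzschild: the slope of the branches at the photon sphere is `c = √(−∂_r²Φ⁰(3𝔪)/(2μ(3𝔪))) = √(18σ²/(6𝔪²)) = √3·σ/𝔪`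
(`𝔪 > 0`, `σ ≥ 0`; module 78 `d2Phi_schwarzschild`: `∂_r²Φ⁰(3𝔪) = −18σ²`). [cite: Hintz2026WavesII, eq. (4.51) TeX l.4733-4737 (Schwarzschild instance, computed here); Dyatlov2015, §3.3 Prop. 3.8 (held arXiv text p.18: '∂_r²G_r = −18τ²/(1−9ΛM²)²')] -/
theorem slopeC_schwarzschild (hm : 0 < m) (hσ : 0 ≤ σ) : slopeC m 0 σ ηφ (3 * m) = Real.sqrt 3 * σ / m := by
  have hμ : mu m 0 (3 * m) = 3 * m ^ 2 := by simp only [mu]; ring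
  rw [slopeC, d2Phi_schwarzschild m σ ηφ hm.ne', hμ]
  have : -(-(18 * σ ^ 2)) / (2 * (3 * m ^ 2)) = 3 * (σ / m) ^ 2 := by field_simp; ring
  rw [this, Real.sqrt_mul (by norm_num : (0:ℝ) ≤ 3), Real.sqrt_sq (div_nonneg hσ hm.le)]
  ring

/-- Schwarzschild: the expansion rate `ν = √(ν²) = √(108𝔪²) = 6√3·𝔪` and `2μ(3𝔪)c = 6𝔪²·√3σ/𝔪 = σν` — so `ν̃ = σν/(H_{G_3b}𝔱) =
6√3𝔪σ/(54𝔪²σ) = 1/(3√3𝔪)`, Dyatlov's value at `Λ = 0` (module 78 `nuSq_schwarzschild`, `nuNormSq_schwarzschild`).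
[cite: Dyatlov2015, §3.3 Prop. 3.8 (held arXiv text p.18: 'ν̃ = √(1−9ΛM²)/(3√3M)'); Hintz2026WavesII, eq. (4.49) TeX l.4708-4711 (Schwarzschild instance, computed here)] -/
theorem rate_schwarzschild (hm : 0 < m) (hσ : 0 < σ) :
    Real.sqrt (nuSq m 0 (3 * m) σ ηφ) = 6 * Real.sqrt 3 * m ∧
      2 * mu m 0 (3 * m) * slopeC m 0 σ ηφ (3 * m) = σ * (6 * Real.sqrt 3 * m) := by
  have h1 : Real.sqrt (nuSq m 0 (3 * m) σ ηφ) = 6 * Real.sqrt 3 * m := by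
    rw [nuSq_schwarzschild m σ ηφ hm.ne' hσ.ne']
    have : (108 : ℝ) * m ^ 2 = 3 * (6 * m) ^ 2 := by ring
    rw [this, Real.sqrt_mul (by norm_num : (0:ℝ) ≤ 3), Real.sqrt_sq (by linarith)]
    ring
  refine ⟨h1, ?_⟩
  rw [slopeC_schwarzschild m σ ηφ hm hσ.le]
  simp only [mu]
  field_simp
  ring

/-- AN EXTREMAL FIBRE, `a = 𝔪`: with `η_ϕ = 𝔪σ` one has `A = −r²σ`, `μ = (r − 𝔪)²`, and with the Carter value `C = 16𝔪²σ²` the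
potential FACTORISES as `Φ⁰(r) = −σ²(r − 2𝔪)²(r² + 4𝔪r − 4𝔪²)/(r − 𝔪)²` (`r ≠ 𝔪`): a double zero at `r' = 2𝔪 ∈ (r₊, 4𝔪] = (𝔪, 4𝔪]`
and `Φ⁰ < 0` elsewhere on `r > 𝔪 = r₊` since `r² + 4𝔪r − 4𝔪² > 0` there — the extremal case of `Phi0_neg_of_ne`, in closed form.
[cite: Hintz2026WavesII, eqs. (4.34), (4.37)-(4.38) TeX l.4520-4524, l.4561-4570 (an extremal instance, computed here); Dyatlov2015, §3.3 Prop. 3.9 (held arXiv text Prop. 2.9 and p.4: as a → M, 'ν_min converges to zero' while the structure persists for each |a| < M)] -/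
theorem Phi0_extremal_fibre (hr : r ≠ m) :
    Phi0 m m σ (m * σ) (16 * m ^ 2 * σ ^ 2) r = -(σ ^ 2 * (r - 2 * m) ^ 2 * (r ^ 2 + 4 * m * r - 4 * m ^ 2)) / (r - m) ^ 2 := by
  have hμ : mu m m r = (r - m) ^ 2 := by simp only [mu]; ring
  have hA : Afn m r σ (m * σ) = -(r ^ 2 * σ) := by simp only [Afn]; ring
  have h1 : r - m ≠ 0 := sub_ne_zero.mpr hr
  simp only [Phi0, Vfn, hA, hμ]
  field_simp
  ring

/-- The extremal fibre is trapped at `r' = 2𝔪` (`Φ⁰(2𝔪) = Ψ(2𝔪) = 0`, `μ(2𝔪) = 𝔪²`), `Φ⁰ < 0` off `2𝔪` on `r > 𝔪` (`𝔪 > 0`, `σ ≠ 0`),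
and module 78's closed form gives `ν² = 16·2𝔪·𝔪³/𝔪² = 32𝔪²` (`ν = 4√2𝔪`, slope `c = σν/(2μ) = 2√2σ/𝔪`) — the fibrewise phase
portrait is non-degenerate AT extremality (what degenerates as `|a| → 𝔪` is the location of the prograde orbit and `ν_min`,
modules 76/78). [cite: Hintz2026WavesII, eqs. (4.37)-(4.38), (4.49) TeX l.4561-4570, l.4708-4711 (extremal instance, computed here); Dyatlov2015, §3.3 Prop. 3.9 (held arXiv text p.4 'ν_min converges to zero' as a → M)] -/
theorem extremal_fibre_trapped (hm : 0 < m) (hσ : σ ≠ 0) :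
    Phi0 m m σ (m * σ) (16 * m ^ 2 * σ ^ 2) (2 * m) = 0 ∧ Psi m m (2 * m) σ (m * σ) = 0 ∧ mu m m (2 * m) = m ^ 2 ∧
      (∀ ρ, m < ρ → ρ ≠ 2 * m → Phi0 m m σ (m * σ) (16 * m ^ 2 * σ ^ 2) ρ < 0) ∧
      16 * (2 * m) * ((2 * m - m) ^ 3 + m * (m ^ 2 - m ^ 2)) / (2 * m - m) ^ 2 = 32 * m ^ 2 := by
  refine ⟨?_, by simp only [Psi, Afn, mu, dmu]; ring, by simp only [mu]; ring, ?_, ?_⟩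
  · rw [Phi0_extremal_fibre m σ (2 * m) (by linarith)]
    simp
  · intro ρ hρ hne
    rw [Phi0_extremal_fibre m σ ρ (ne_of_gt hρ)]
    have h1 : 0 < σ ^ 2 * (ρ - 2 * m) ^ 2 * (ρ ^ 2 + 4 * m * ρ - 4 * m ^ 2) := by
      have := sq_pos_of_ne_zero (sub_ne_zero.mpr hne)
      have := sq_pos_of_ne_zero hσ
      have : 0 < ρ ^ 2 + 4 * m * ρ - 4 * m ^ 2 := by nlinarith
      positivity
    have h2 : 0 < (ρ - m) ^ 2 := sq_pos_of_ne_zero (by linarith)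
    rw [neg_div]
    exact neg_neg_of_pos (div_pos h1 h2)
  · have hm0 : 2 * m - m ≠ 0 := by linarith
    field_simp
    ring

end WorkedFibres

end Literature.Geometry.Lorentzian.Hintz2026.KerrTrappingPhasePortrait
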